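import Literature.MathematicalPhysics.QuantumFieldTheory.Balaban1983to89.Beta.OneStepKernelFamily

/-!
# `Balaban1983to89.Beta.HessianTelescopingKKT` — the EXIT-B predicate `D1Tel` from a ONE-STEP transport recursion of the
# one-shot Hessian kernels (β sub-cell, delegated node P6 «D1Tel-KKT», row BETA-an4 gen 15; KKT-composition bookkeeping, LAYER 1)
# VERSIONS: v1 p188688 (§1–§5); v1.1 p188794: + §6 — reproduction data of dilated patterns and of the `ℋ`-column of `KInvStep`, the
canonical weight `wStep` and `d1Tel_of_stepRecursion_wStep` (the weight-side binders of §4 DISCHARGED); v1.2 p188818 = v1.1 + docstring-only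
fixes (literal ABSOLUTE RULE sentence; `wStep` = beta-an2's bond-unit convention (A2), journal l.53794, literally); v1.3 p189326 = v1.2 +
§7/§8 APPEND-ONLY (the recursion MODULO A REMAINDER and its sockets at the kernel-entry, second-moment and read-out level — the typed home
of the β sub-cell lead's RULING (R26-2), journal l.54484, for the support item P6c «LongitudinalCancellation»); §1–§6 unchanged; no new import.
v1.4 (this file) = v1.3 + §9 APPEND-ONLY (the read-out socket restated by SECOND MOMENTS = the literal unfolding of the lead's `StepDriftWitness.D1Sum`,
RULING (R27), journal l.54841); §1–§8 unchanged; no new import.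

HONEST FRAMING (cell `pub-balaban`, BETA-SPEC, verbatim): discharging `BetaPertH` makes Bałaban's UV stability
UNCONDITIONAL — a real constructive-QFT result; it is NOT the continuum limit and NOT the Clay problem.  THIS MODULE
DISCHARGES NOTHING of `BetaPertH` and asserts NOTHING about Bałaban's kernels, jets or β-functions: every theorem is an
implication between HYPOTHESIS SHAPES on ABSTRACT families of matrix kernels `T 𝒯 : ℕ → EKer 4` and transport weights
`w : ℕ → EKer 4`, specialised BY NAME to the typed families `OneStepKernelFamily.TbalOf Lc Js` / `TshotOf Lc Jc` over ABSTRACT jet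
data `Js`, `Jc`.  Every declaration is `[folklore]`: a definition, finite-sum / `tsum` bookkeeping proved here, or a composition BY
NAME of landed modules (`DressedMomentNormalisation.bondSecondMoment_hasSum_four` = the `d = 4` marginality of an admissible
dressing, `ScalewiseVectorSeam.hessianTelescoping_iff_m2Tensor_sum`, `OneStepKernelFamily.hTA_TbalOf`), all imported untouched.
Value = a typed reduction (LAYER 1 of the delegated node) + the precisely typed remaining predicate (LAYER 2), NOT summit progress.

ABSOLUTE RULE (cell charter, verbatim; literal sentence restored v1.2 per lit2 XREAD C-lit2g18-7 D1, docstring-only): «No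
internally-minted statement may enter as a cited fact. Every hypothesis is either kernel-proved in this package or a
verbatim quotation of a PUBLISHED theorem with page reference. The manuscript(s) under audit are NOT citable for their
own disputed steps — they are the thing under adjudication; programme-internal (2001/route/tribunal) claims are never
citable.»  NOTHING below is cited: there is no `[cite: …]` tag and no `Prop` mirroring a printed claim in this file; the
hypotheses (R0)–(R2), (T0), (T1) of the theorems are BINDERS (beta-ref R419 (a)), and the conclusion is
`OneStepKernelFamily.D1Tel Lc Js Jc` BY NAME.

PRINTED CONTEXT (orientation only; nothing of it is used).  T. Bałaban, *Renormalization group approach to lattice gauge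
field theories. I*, Commun. Math. Phys. **109** (1987) 249–301 [B12], p. 264, (1.20)–(1.22): `Π_{j+1}` is the `B`-Hessian at
`0` of the effective action `E^{(j+1)}`, «the vacuum polarization tensor of the theory defined by the j-th fluctuation field
integral», and `β_{j+1}(g_j) = Σ_x Π_{j+1,μν}(g_j, x) x_μ x_ν`.  The cell's reading (R23)/`D1Tel` — the one-step Hessian kernels
telescope onto the Hessian kernel of the composite («one-shot») transformation — is KKT-composition ALGEBRA of constrained
Gaussian integrals (composition law of the averaging operations, chain rule, vanishing first variations); p. 264 prints no
such statement and none is quoted as one.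

THE NODE (journal `CLAIMS.log` l.52886, DELEGATION by beta-an2-g8, trigger (t5); CLAIM l.53177).  Target, verbatim tree decls
(`OneStepKernelFamily` §6): `D1Tel Lc Js Jc := HessianTelescoping Lc (TbalOf Lc Js) (TshotOf Lc Jc)` with
`HidentScalewise.HessianTelescoping Lc T 𝒯 := ∀ m ≥ 1, Σ_{j<m} coarseTensor (Lc^(m−j)) (wK (Lc^(m−j))) (T j) = m2Tensor (𝒯 m)`.
Two facts fix the shape of any honest proof.  (i) At TENSOR level every admissible dressing is invisible
(`coarseTensor_eq_m2Tensor`): under the socket's per-step data (hTA, (T0), (T1)) `D1Tel` IS second-moment additivity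
`m2Tensor (𝒯 m) = Σ_{j<m} m2Tensor (T j)` (`hessianTelescoping_iff_m2Tensor_sum`, in the tree).  (ii) At KERNEL level the unrolled
form `HidentScalewise.KernelTelescoping` (dressing of `T j` by the FREE minimiser `wK (Lc^(m−1−j))`) is false for generic kernels
already at `m = 1` (beta-an2 X-an2-32: `dec 1 = id` but `wK Lc ≠ δ`), and for `m ≥ 2` the true multi-step transport is the response of
the level-`j` EFFECTIVE system, not `wK`.  The honest kernel-level content is therefore the ONE-STEP RECURSION proved FROM the
composition of two constrained Gaussian steps — and this file isolates exactly what of it `D1Tel` consumes.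

WHAT THIS MODULE PROVES ([folklore]; §-numbers below).
§1  `m2Tensor_eq_sum_of_step`: second-moment additivity from a base identity at `m = 1` and a one-step identity
    `m2Tensor (𝒯 (j+1)) = m2Tensor (𝒯 j) + m2Tensor (T j)` (`j ≥ 1`) — induction, nothing else.
§2  THE ONE-STEP TRANSPORT RECURSION (LAYER 2's predicate, stated here): `StepRecursion Lc T 𝒯 w := ∀ j ≥ 1, ∀ a b z,
    𝒯 (j+1) a b z = Lc^8 · dressedEntry (w j) (𝒯 j) (Lc•z) a b + T j a b z` — the Hessian kernel of the `(j+1)`-fold blocking is the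
    level-`j` one-shot kernel TRANSPORTED through a one-step response weight `w j` (both bond legs, `DressedMomentNormalisation.dressedEntry`,
    sampled on the `Lc`-coarser lattice with the bond-unit prefactor `Lc^8 = Lc^{2d}`, §3 of that file) PLUS the step-`j` kernel; and
    `AdmissibleTransport Lc 𝒯 w := ∀ j ≥ 1, EntryHyps Lc (w j) (𝒯 j)` (Kronecker coset masses `δ·Lc^{-5}`, affine reproduction,
    absolutely summable second moments of `w j`; (T0)/(T1)/AbsMoment₂ of the level-`j` ONE-SHOT kernel).  Then
    `hasSum_transport_m2Tensor` (the transported term has the SAME second-moment tensor as `𝒯 j` — `bondSecondMoment_hasSum_four` BY NAME),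
    `m2Tensor_step_of_stepRecursion`, and `hessianTelescoping_of_stepRecursion`:
    hTA/(T0)/(T1) of `T` + `AdmissibleTransport` + (R0) `m2Tensor (𝒯 1) = m2Tensor (T 0)` + `StepRecursion` ⟹ `HessianTelescoping Lc T 𝒯`.
§3  WARD DATA ARE INHERITED: `hasSum_dressedSum_zero_lattice` / `hasSum_dressedSum_first_lattice` (the zeroth and first DECIMATED moments of
    a two-sided dressed sum vanish when the left pattern reproduces constants (and affine functions) through `N•ℤ^d` and the kernel has (T0)
    ((T0) and (T1)) — `DecimatedMomentSummable.hasSum_term_left_of_zero` / `hasSum_term_first` regrouped by the coarse point and decimated, BY NAME),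
    `hasSum_dressedEntry_zero` / `_first` (entrywise under `EntryHyps`), `wardData_succ_of_stepRecursion`, and
    `admissibleTransport_of_stepRecursion`: reproduction data of the weights `w j` + AbsMoment₂ of `𝒯` + (T0)/(T1) of the STEP kernels and of
    `𝒯 1` + `StepRecursion` ⟹ `AdmissibleTransport` (induction on `j`) — the one-shot kernels need NO Ward identities of their own.
§4  THE NODE'S THEOREMS over jet data: `d1Tel_of_stepRecursion` — binders (T0)/(T1) for `TbalOf Lc Js` (hTA is `hTA_TbalOf` BY NAME),
    (R0) `m2Tensor (TshotOf Lc Jc 1) = m2Tensor (TbalOf Lc Js 0)`, (R1) = `StepRecursion Lc (TbalOf Lc Js) (TshotOf Lc Jc) w`,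
    (R2) = `AdmissibleTransport Lc (TshotOf Lc Jc) w`; conclusion `D1Tel Lc Js Jc` BY NAME; `d1Tel_of_stepRecursion'` (base in kernel form);
    `d1Tel_of_stepRecursion_of_stepWard` — THE FORM LAYER 2 SHOULD TARGET: (T0)/(T1) of the step kernels, the REPRODUCTION DATA of the
    weights (`ConstReproSum Lc (w j κ l) (δ_{κl}·Lc^{-5})`, `LinReproSum`, AbsMoment₂), the base `TshotOf Lc Jc 1 = TbalOf Lc Js 0` and (R1)
    ⟹ `D1Tel Lc Js Jc` (AbsMoment₂ of the one-shot kernels is `absMoment₂_TshotOf`, their Ward data inherited by §3); and the converse bookkeeping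
    `m2Tensor_step_of_d1Tel` (`D1Tel` ⟹ the one-step identity of second-moment tensors), so LAYER 2 is asked for no more than `D1Tel` needs up to
    the kernel-level form of the transport.  The recursion is ONE-STEP (relative blocking `Lc` at every `j`), so X-an2-32 does not arise: the
    base `m = 1` is the separate binder (R0) and no `(m−1−j)`-indexed dressing occurs anywhere.
§5  Base-case support for (R0): `legSet_one`, `legW_one`, `legPt_one`, `dec_one` (`OneStepKernelFamily.dec 1 = id`: the `1`-fold block-contour
    decimation reads the kernel), `kInvStep_zero` (`KInvStep Lc 0 = KInv (N := Lc^1)`), `tbalOf_zero` (the step-`0` kernel is the resolvent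
    Hessian kernel of `KInv (N := Lc^1)` with the chain-rule vertex through its own `ℋ`-column).

WHAT REMAINS (LAYER 2, NOT proved here; the v2 target of this node, SPEC in journal X-an4-37 / `HOME/b2b-balaban-beta-an4/g15/X-an4-37.md`):
(R1) with Bałaban's data, i.e. `StepRecursion Lc (TbalOf Lc Js) (TshotOf Lc (JcRec Js)) w` for the composite jets `JcRec` of beta-an2's (D-μ)
(`InterLevelTransport.transportV/transportW`, p188335) and the step response weight `w j` = the suitably NORMALISED `ℋ`-column of
`KInvStep Lc j` (X-an4-37: the `Lc`-coset mass of `w j κ l` must be `δ_{κl}·Lc^{-5}` for (R2); the literal column `colH (KInvStep Lc j) Lc` has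
coset mass `δ·Lc^{-5j-5}`, so the powers of `Lc` in `JcRec` are load-bearing), from (H1) the kernel-level composition identities of the packed
resolvents (an2's (K1a)–(K1c), with one factor `(Lc^j)^{d+2}` per field-type slot of `InterLevelTransport.lift`, X-an4-37 (F5)), (H2) the jet
recursion, (H3) the vanishing of the odd cross terms, (H0) the KKT row relations `Q_j ℋ_j = 1`, `Q_j 𝒢_j = 0`.  Its finite-dimensional content is
`½·d²/ds²` of `log det 𝕂_{j+1}(s) = log det 𝕂_j(s) + log det 𝕂^st_j(s) + const` (Schur complement / Woodbury, exact including the Lagrange term).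
(R2) reduces by §3 to the REPRODUCTION DATA of the weights `w j`, and §6 (v1.1) PROVES those data for the canonical weight
`wStep Lc j κ l p := Lc^{5j} · KInvStep Lc j (−p) 0 (inl κ) (inr l)` (constant reproduction through `Lc•ℤ^4` with Kronecker mass `Lc^{−5}`,
affine reproduction, AbsMoment₂ — from `KernelSpecInstance.lowMomentsSum_specK` through `dec` by the dilation–translation reindexing
`hasSum_cosetWindow_dilate`), so that `d1Tel_of_stepRecursion_wStep` leaves EXACTLY: (T0)/(T1) of the step kernels, the base identity
`TshotOf Lc Jc 1 = TbalOf Lc Js 0`, and (R1) with `w = wStep Lc`.  Whether Bałaban's composite jets satisfy (R1) with THIS weight (orientation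
`−p`, factor `Lc^{5j}`) or with a reflected / differently split normalisation is LAYER 2's to settle (the reproduction lemmas of §6 are
insensitive to `p ↦ −p` and to moving scalar factors between the two legs and the kernel only through the stated masses).  `D1Rep` (the
analytic EXIT-B binder) is untouched by this file.
§6  (v1.1) `cosetInd_mul_zsmul`, `hasSum_cosetWindow_dilate` (the `L`-coset window sum of `p ↦ φ (c − M•p)` at `a` IS the `M·L`-coset window
    sum of `φ` at `c − M•a`: `Function.Injective.hasSum_iff`), `constReproSum_dilate` / `linReproSum_dilate` (reproduction data inherited by
    dilated-translated patterns, SAME mass), `constReproSum_const_mul` / `linReproSum_const_mul` / `absMoment₂_const_mul'`, `legOff`,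
    `stepCol` + `stepCol_eq` (the column is the `(Lc^j)^{−(d+2)}`-weighted mean of `wH_{Lc^{j+1}}` over the leg offsets), `KInv_inl_inr_zero`,
    **`constReproSum_stepCol`** (the `Lc`-coset Kronecker mass of the RAW column is `(Lc^{j+1})^{−(d+2)}` — for `d = 3` the count
    `δ·Lc^{−5j−5}` of X-an4-37, now kernel-checked), `linReproSum_stepCol`, `absMoment₂_stepCol`, `wStep`, `constReproSum_wStep` (mass `Lc^{−5}`
    at every `j`), `linReproSum_wStep`, `absMoment₂_wStep`, **`d1Tel_of_stepRecursion_wStep`**.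
§7  (v1.3) THE RECURSION MODULO A REMAINDER (RULING (R26-2) of the β sub-cell lead, journal l.54484: the KKT composition within one gauge
    slice leaves «an explicit longitudinal remainder», and the support item P6c «LongitudinalCancellation» is to be stated «at kernel-entry
    level if the contact terms cancel entrywise, else at the μ ≠ ν second-moment level — then (R1)/`StepRecursion` weakens to its `m2Tensor`
    form, which is ALL that `D1Tel` consumes»).  `StepRecursionUpTo Lc T 𝒯 w R := ∀ j ≥ 1, ∀ a b z, 𝒯 (j+1) a b z = Lc^8 · dressedEntry (w j)
    (𝒯 j) (Lc•z) a b + T j a b z + R j a b z` — the recursion WITH an explicit remainder family `R : ℕ → EKer 4` (P6c at KERNEL-ENTRY level =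
    `R = 0`: `stepRecursionUpTo_zero_iff`; with `R := stepDefect Lc T 𝒯 w` it holds for free, `stepRecursionUpTo_stepDefect`, so ALL content
    is in the moments of `R`; `stepRecursion_iff_stepDefect_eq_zero`; `stepRecursionUpTo_iff_stepRecursion_add`: a remainder is a modified step
    family).  Tensor level: `m2Tensor_step_of_stepRecursionUpTo` (`m2Tensor (𝒯 (j+1)) = m2Tensor (𝒯 j) + m2Tensor (T j) + m2Tensor (R j)`);
    Ward inheritance with remainder: `wardData_succ_of_stepRecursionUpTo`, `admissibleTransport_of_stepRecursionUpTo` (the zeroth and first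
    decimated moments of `R j`, `j ≥ 1`, enter — or the one-shot Ward data are supplied directly as `AdmissibleTransport`);
    `hessianTelescoping_of_stepRecursionUpTo` with the binder `hR2 : ∀ j ≥ 1, m2Tensor (R j) = 0` = P6c AT THE SECOND-MOMENT LEVEL (all
    components).  READ-OUT level, for ANY additive `F : Tensor4 → ℝ`: `readout_eq_sum_of_step` (bookkeeping) and
    `readout_sum_of_stepRecursionUpTo … (hRF : ∀ j ≥ 1, F (m2Tensor (R j)) = 0) : ∀ m ≥ 1, F (m2Tensor (𝒯 m)) = Σ_{j<m} F (m2Tensor (T j))`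
    = P6c AT THE READ-OUT LEVEL — e.g. `F := ScalewiseVectorSeam.readout122 μ ν` (`M ↦ M μ ν μ ν`, additive by `readout122_add`), the ONE
    functional through which EXIT-B consumes `D1Tel` (`HidentScalewise.flowSum_eq_oneShotReadout` inside `ScalewiseVectorSeam.hU_of_scalewise`):
    the read-out-level identity is exactly the conclusion `Σ_{j<m} β⁰_j = F (m2Tensor (𝒯 m))` of `flowSum_eq_oneShotReadout` (with
    `β⁰_j := F (m2Tensor (T j))`), strictly weaker than `D1Tel` (all `4⁴` components); whether EXIT-B's `htel` binder is re-cut to that level is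
    the lead's seam decision, not this file's.
§8  (v1.3) THE NODE'S THEOREMS MODULO A REMAINDER over jet data with the canonical weight: `d1Tel_of_stepRecursionUpTo` (one-shot Ward data
    as `AdmissibleTransport`; remainder binders `hRA`, `hR2` only), **`d1Tel_of_stepRecursionUpTo_wStep (hT0) (hT1) (hR0) (hR1) (hRA) (hR2)
    (hbase : TshotOf Lc Jc 1 = TbalOf Lc Js 0) (hrec : StepRecursionUpTo Lc (TbalOf Lc Js) (TshotOf Lc Jc) (wStep Lc) R) : D1Tel Lc Js Jc`**
    (P6c at the second-moment level: the remainder's decimated moments of order 0, 1 vanish, its second moments are absolutely summable and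
    its second-moment TENSOR vanishes, `j ≥ 1`), **`flowSum_of_stepRecursionUpTo_wStep … (hRF : ∀ j ≥ 1, F (m2Tensor (R j)) = 0) : ∀ m ≥ 1,
    F (m2Tensor (TshotOf Lc Jc m)) = Σ_{j<m} F (m2Tensor (TbalOf Lc Js j))`** (P6c at the read-out level), and the transport-free
    second-moment socket `d1Tel_of_m2Step` / `d1Tel_iff_m2Step` (with v1's `m2Tensor_step_of_d1Tel`).  NOTHING of (R1), of P6c, of the
    corrected transverse identities (K1′) (beta-an5 `ResolventComposition`) is derived or bound here: (R1) — now «(R1) modulo `R`» — REMAINS A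
    HYPOTHESIS by (R26-2)(iii) and beta-an2's instruction (journal l.54172); the remainder `R` and every hypothesis on it are BINDERS.
§9  (v1.4) THE READ-OUT SOCKET BY SECOND MOMENTS (RULING (R27) of the β sub-cell lead, journal l.54841: the (D1) telescoping binder is cut at the
    read-out level; the lead's `StepDriftWitness.D1Sum Lc Js Jc μ ν := ReadoutSum (fun j => secondMoment (TbalOf Lc Js j) μ ν) (TshotOf Lc Jc) μ ν`,
    `d1Sum_iff` = `Iff.rfl`): **`secondMomentSum_of_stepRecursionUpTo_wStep (Js Jc) {R} (μ ν) (hT0) (hT1) (hR0) (hR1) (hRA)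
    (hRF : ∀ j ≥ 1, secondMoment (R j) μ ν = 0) (hbase) (hrec) : ∀ m ≥ 1, Σ_{j<m} secondMoment (TbalOf Lc Js j) μ ν = secondMoment (TshotOf Lc Jc m) μ ν`**
    — LITERALLY the unfolding of `D1Sum Lc Js Jc μ ν` (this module cannot name `D1Sum`: `StepDriftWitness` imports it; a consumer closes with
    `(StepDriftWitness.d1Sum_iff Js Jc μ ν).2 (secondMomentSum_of_stepRecursionUpTo_wStep …)` or by `exact`), and `…_m2` (the same from
    `hR2 : ∀ j ≥ 1, m2Tensor (R j) = 0`).  = §8's `flowSum_of_stepRecursionUpTo_wStep` at `F := ScalewiseVectorSeam.readout122 μ ν` rewritten by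
    `readout122_m2Tensor`; nothing new is assumed.
-/

open Finset
open scoped BigOperators
open Literature.MathematicalPhysics.QuantumFieldTheory.Balaban1983to89
open Literature.MathematicalPhysics.QuantumFieldTheory.Balaban1983to89.Beta
open DecimatedMoment (cosetInd cosetInd_sub_comm)
open DecimatedMomentLimit (hasSum_decimate_iff abs_cosetInd_le_one cosetInd_eq_zero_of_not_mem_range dilate_injective)
open DecimatedMomentSummable (AbsMoment₂ IsMoment₂ summable_smul_of_absMoment₂ term mono MonoSummable monoSummable_of_absMoment₂
  hasSum_term_left_of_zero hasSum_window_one hasSum_one_smul hasSum_term_first hasSum_coarse summable_dressed_fibre dressedSum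
  ConstReproSum LinReproSum absMoment₂_of_decay510)
open KernelSpecInstance (wH lowMomentsSum_specK)
open B12Sec2to5 (l1)
open DressedMomentNormalisation (EKer m2Tensor coarseTensor dressedEntry EntryHyps bondSecondMoment_hasSum_four
  hasSum_total_of_constReproSum)
open HidentScalewise (HessianTelescoping)
open ScalewiseVectorSeam (hessianTelescoping_iff_m2Tensor_sum)
open ExpKernelCalculus (hessKer)
open OneStepResolventKernel (Fib KInv JetData TOf KInv_inl_inr_coarse)
open OneStepKernelFamily (dec legSet legPt legW LegIdx KInvStep vertexOfK TstepOf TbalOf TshotOf D1Tel hTA_TbalOf decays_KInvStep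
  sum_legW l1_neg_eq)

noncomputable section

namespace Literature.MathematicalPhysics.QuantumFieldTheory.Balaban1983to89.Beta.HessianTelescopingKKT

/-! ## §1 Second-moment additivity from a one-step identity -/

section Additivity

/-- **ADDITIVITY BY INDUCTION.**  If the second-moment tensor of `𝒯 1` is that of `T 0` and, for every `j ≥ 1`, that of `𝒯 (j+1)` is that
of `𝒯 j` plus that of `T j`, then `m2Tensor (𝒯 m) = Σ_{j<m} m2Tensor (T j)` for every `m ≥ 1`. [folklore] -/
theorem m2Tensor_eq_sum_of_step {T 𝒯 : ℕ → EKer 4} (hbase : m2Tensor (𝒯 1) = m2Tensor (T 0))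
    (hstep : ∀ j : ℕ, 1 ≤ j → m2Tensor (𝒯 (j + 1)) = m2Tensor (𝒯 j) + m2Tensor (T j)) :
    ∀ m : ℕ, 1 ≤ m → m2Tensor (𝒯 m) = ∑ j ∈ range m, m2Tensor (T j) := by
  intro m hm
  induction m, hm using Nat.le_induction with
  | base => rw [Finset.sum_range_one, hbase]
  | succ m hm ih => rw [hstep m hm, ih, Finset.sum_range_succ]

end Additivity

/-! ## §2 The one-step transport recursion and what it gives at tensor level -/

section Recursion

/-- **THE ONE-STEP TRANSPORT RECURSION** of a pair of kernel families (`T j` = step-`j` kernel on the level-`j` lattice, blocking `Lc`;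
`𝒯 m` = one-shot kernel of the `m`-fold blocking) through the one-step response weights `w j : EKer 4` (`w j c a p` = response of the
level-`j` bond `(c, ·)` at relative position `−p` to the level-`(j+1)` bond `(a, ·)`): for every `j ≥ 1` and every coarse bond pair,
`𝒯 (j+1) a b z = Lc^8 · dressedEntry (w j) (𝒯 j) (Lc•z) a b + T j a b z` — the chain rule through the step-`j` response on both legs
(`dressedEntry w 𝒯 y a b = Σ_{c,e} Σ'_{p₁,p₂} w c a p₁ · 𝒯 c e (y + p₁ − p₂) · w e b p₂`) in the BOND units of `DressedMomentNormalisation` §3,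
plus the new step's own Hessian kernel.  ONE step of relative blocking `Lc` at every `j`: no `(m−1−j)`-fold dressing index (X-an2-32-safe);
the base `m = 1` is a separate binder.  A PREDICATE — for Bałaban's data it is LAYER 2 of the node (header, WHAT REMAINS). [folklore] -/
def StepRecursion (Lc : ℕ) (T 𝒯 : ℕ → EKer 4) (w : ℕ → EKer 4) : Prop :=
  ∀ j : ℕ, 1 ≤ j → ∀ (a b : Fin 4) (z : Fin 4 → ℤ),
    𝒯 (j + 1) a b z = (Lc : ℝ) ^ 8 * dressedEntry (w j) (𝒯 j) ((Lc : ℤ) • z) a b + T j a b z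

/-- **ADMISSIBLE TRANSPORT**: at every `j ≥ 1` the pair (response weight `w j`, transported kernel `𝒯 j`) satisfies the entrywise hypotheses
`DressedMomentNormalisation.EntryHyps Lc` — Kronecker coset masses `δ_{κl}·Lc^{-5}` (constant reproduction), affine reproduction, absolutely
summable second moments of `w j`; AbsMoment₂, (T0) and (T1) of `𝒯 j`.  For Bałaban's data: the reproduction properties of the (normalised)
step minimiser and the Ward identities of the level-`j` one-shot kernel. [folklore] -/
def AdmissibleTransport (Lc : ℕ) (𝒯 : ℕ → EKer 4) (w : ℕ → EKer 4) : Prop :=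
  ∀ j : ℕ, 1 ≤ j → EntryHyps Lc (w j) (𝒯 j)

/-- **THE TRANSPORTED TERM HAS THE SECOND-MOMENT TENSOR OF THE TRANSPORTED KERNEL** (`d = 4` marginality of an admissible dressing,
`DressedMomentNormalisation.bondSecondMoment_hasSum_four` BY NAME, rewritten with `•`). [folklore] -/
theorem hasSum_transport_m2Tensor {N : ℕ} {w 𝒯 : EKer 4} (h : EntryHyps N w 𝒯) (κ lam a b : Fin 4) :
    HasSum (fun z : Fin 4 → ℤ => (z κ * z lam) • ((N : ℝ) ^ 8 * dressedEntry w 𝒯 ((N : ℤ) • z) a b))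
      (m2Tensor 𝒯 κ lam a b) := by
  have hm := bondSecondMoment_hasSum_four h.pos w 𝒯 h.const h.lin h.absW h.absT h.T0 h.T1 κ lam a b
  refine hm.congr_fun fun z => ?_
  rw [zsmul_eq_mul, Int.cast_mul]

/-- **ONE STEP AT TENSOR LEVEL**: under hTA of `T`, admissible transport and the one-step recursion,
`m2Tensor (𝒯 (j+1)) = m2Tensor (𝒯 j) + m2Tensor (T j)` for every `j ≥ 1`. [folklore] -/
theorem m2Tensor_step_of_stepRecursion {Lc : ℕ} {T 𝒯 : ℕ → EKer 4} {w : ℕ → EKer 4}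
    (hTA : ∀ j (c e : Fin 4), AbsMoment₂ (T j c e)) (hw : AdmissibleTransport Lc 𝒯 w) (hrec : StepRecursion Lc T 𝒯 w) :
    ∀ j : ℕ, 1 ≤ j → m2Tensor (𝒯 (j + 1)) = m2Tensor (𝒯 j) + m2Tensor (T j) := by
  intro j hj
  funext κ lam a b
  have hA := hasSum_transport_m2Tensor (hw j hj) κ lam a b
  have hB : Summable (fun t : Fin 4 → ℤ => (t κ * t lam) • T j a b t) :=
    summable_smul_of_absMoment₂ (hTA j a b) (IsMoment₂.coord2 κ lam)
  show m2Tensor (𝒯 (j + 1)) κ lam a b = m2Tensor (𝒯 j) κ lam a b + m2Tensor (T j) κ lam a b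
  calc m2Tensor (𝒯 (j + 1)) κ lam a b
      = ∑' t : Fin 4 → ℤ, ((t κ * t lam) • ((Lc : ℝ) ^ 8 * dressedEntry (w j) (𝒯 j) ((Lc : ℤ) • t) a b)
          + (t κ * t lam) • T j a b t) := by
        simp only [m2Tensor]
        exact tsum_congr fun t => by rw [hrec j hj a b t, smul_add]
    _ = m2Tensor (𝒯 j) κ lam a b + m2Tensor (T j) κ lam a b := by
        rw [Summable.tsum_add hA.summable hB, hA.tsum_eq]
        rfl

/-- **HESSIAN TELESCOPING FROM THE ONE-STEP RECURSION** (abstract families).  Per-step data hTA/(T0)/(T1) of `T` (they turn the pulled-back coarse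
tensors of `HessianTelescoping` into second-moment tensors, `hessianTelescoping_iff_m2Tensor_sum`), admissible transport, the base identity (R0) and
the recursion give `HidentScalewise.HessianTelescoping Lc T 𝒯`. [folklore] -/
theorem hessianTelescoping_of_stepRecursion {Lc : ℕ} [NeZero Lc] {T 𝒯 : ℕ → EKer 4} {w : ℕ → EKer 4}
    (hTA : ∀ j (c e : Fin 4), AbsMoment₂ (T j c e)) (hT0 : ∀ j (c e : Fin 4), HasSum (T j c e) 0)
    (hT1 : ∀ j (c e ρ : Fin 4), HasSum (fun t : Fin 4 → ℤ => t ρ • T j c e t) 0)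
    (hw : AdmissibleTransport Lc 𝒯 w) (hbase : m2Tensor (𝒯 1) = m2Tensor (T 0)) (hrec : StepRecursion Lc T 𝒯 w) :
    HessianTelescoping Lc T 𝒯 :=
  (hessianTelescoping_iff_m2Tensor_sum hTA hT0 hT1).2
    (m2Tensor_eq_sum_of_step hbase (m2Tensor_step_of_stepRecursion hTA hw hrec))

end Recursion


/-! ## §3 Ward data are INHERITED along the recursion: zeroth and first decimated moments of an admissible dressing vanish -/

section Inherit

variable {d : ℕ}

/-- **ZEROTH DECIMATED MOMENT OF A DRESSED SUM VANISHES WITH (T0)**: if the left pattern reproduces constants through `N•ℤ^d`, the three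
factors have absolutely summable second moments and `Σ T = 0`, then `Σ_z dressedSum w T w' (N•z) = 0` (`hasSum_term_left_of_zero` regrouped by
the coarse point, `hasSum_coarse`, and read on the coarse lattice, `hasSum_decimate_iff`). [folklore] -/
theorem hasSum_dressedSum_zero_lattice {N : ℕ} (hN : N ≠ 0) {w T w' : (Fin d → ℤ) → ℝ} {σ : ℝ}
    (hw : ConstReproSum N w σ) (hwA : AbsMoment₂ w) (hTA : AbsMoment₂ T) (hw'A : AbsMoment₂ w') (hT0 : HasSum T 0) :
    HasSum (fun z : Fin d → ℤ => dressedSum w T w' ((N : ℤ) • z)) 0 := by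
  have hS : MonoSummable (cosetInd N) w T w' := monoSummable_of_absMoment₂ (abs_cosetInd_le_one N) hwA hTA hw'A
  have h0 : HasSum (term (cosetInd N) w T w' (mono (fun _ => 1) (fun _ => 1) (fun _ => 1))) 0 :=
    hasSum_term_left_of_zero (cosetInd N) w T w' (fun _ => 1) (hasSum_window_one (cosetInd N) w hw) _ _
      (hasSum_one_smul hT0) (hS _ _ _ .one .one .one)
  have e : (mono (fun _ => (1 : ℤ)) (fun _ => 1) (fun _ => 1) : (Fin d → ℤ) → (Fin d → ℤ) → (Fin d → ℤ) → ℤ)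
      = fun u t x => (fun _ => (1 : ℤ)) (t + x - u) := by
    funext u t x
    simp only [mono, mul_one]
  rw [e] at h0
  have hc := hasSum_coarse (cosetInd N) w T w' (fun _ => (1 : ℤ)) h0 (fun y => summable_dressed_fibre hwA hTA hw'A y)
  have hl := (hasSum_decimate_iff hN (fun _ => (1 : ℤ)) (dressedSum w T w') 0).2 hc
  simpa only [one_smul] using hl

/-- **FIRST DECIMATED MOMENT OF A DRESSED SUM VANISHES WITH (T0), (T1)**: left pattern reproducing constants and affine functions, right pattern
reproducing constants, absolutely summable second moments, `Σ T = 0` and `Σ t_μ T = 0`; then `Σ_z z_μ • dressedSum w T w' (N•z) = 0`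
(`hasSum_term_first` with vanishing `T`-moments, regrouped and decimated as above, divided by `N`). [folklore] -/
theorem hasSum_dressedSum_first_lattice {N : ℕ} (hN : 0 < N) {w T w' : (Fin d → ℤ) → ℝ} {σ σ' : ℝ} {C : Fin d → ℝ}
    (hw : ConstReproSum N w σ) (hwL : LinReproSum N w C) (hw' : ConstReproSum N w' σ')
    (hwA : AbsMoment₂ w) (hTA : AbsMoment₂ T) (hw'A : AbsMoment₂ w') (hT0 : HasSum T 0) (μ : Fin d)
    (hT1 : HasSum (fun t => t μ • T t) 0) :
    HasSum (fun z : Fin d → ℤ => z μ • dressedSum w T w' ((N : ℤ) • z)) 0 := by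
  have hS : MonoSummable (cosetInd N) w T w' := monoSummable_of_absMoment₂ (abs_cosetInd_le_one N) hwA hTA hw'A
  have hn0 := hasSum_total_of_constReproSum hN hw'
  have hn1 := (summable_smul_of_absMoment₂ hw'A (IsMoment₂.coord μ)).hasSum
  have h1 := hasSum_term_first (cosetInd N) w T w' hw hwL μ hT0 hT1 hn0 hn1 hS
  simp only [mul_zero, zero_mul, add_zero, sub_zero] at h1
  have hc := hasSum_coarse (cosetInd N) w T w' (fun y => y μ) h1 (fun y => summable_dressed_fibre hwA hTA hw'A y)
  have hl := (hasSum_decimate_iff hN.ne' (fun y => y μ) (dressedSum w T w') 0).2 hc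
  have hl' : HasSum (fun z : Fin d → ℤ => (N : ℝ)⁻¹ * ((((N : ℤ) • z) μ) • dressedSum w T w' ((N : ℤ) • z))) 0 := by
    simpa only [mul_zero] using hl.mul_left ((N : ℝ)⁻¹)
  refine hl'.congr_fun fun z => ?_
  have hN' : (N : ℝ) ≠ 0 := by exact_mod_cast hN.ne'
  simp only [Pi.smul_apply, smul_eq_mul, zsmul_eq_mul, Int.cast_mul, Int.cast_natCast]
  field_simp

/-- The decimated ZEROTH moment of every entry of an admissibly dressed kernel vanishes. [folklore] -/
theorem hasSum_dressedEntry_zero {N : ℕ} {w 𝒯 : EKer 4} (h : EntryHyps N w 𝒯) (a b : Fin 4) :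
    HasSum (fun z : Fin 4 → ℤ => dressedEntry w 𝒯 ((N : ℤ) • z) a b) 0 := by
  have h0 : ∀ c e : Fin 4, HasSum (fun z : Fin 4 → ℤ => dressedSum (w c a) (𝒯 c e) (w e b) ((N : ℤ) • z)) 0 :=
    fun c e => hasSum_dressedSum_zero_lattice h.pos.ne' (h.const c a) (h.absW c a) (h.absT c e) (h.absW e b) (h.T0 c e)
  have hs := hasSum_sum (s := (Finset.univ : Finset (Fin 4))) fun c _ =>
    hasSum_sum (s := (Finset.univ : Finset (Fin 4))) fun e _ => h0 c e
  simp only [Finset.sum_const_zero] at hs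
  simpa only [dressedEntry] using hs

/-- The decimated FIRST moments of every entry of an admissibly dressed kernel vanish. [folklore] -/
theorem hasSum_dressedEntry_first {N : ℕ} {w 𝒯 : EKer 4} (h : EntryHyps N w 𝒯) (a b μ : Fin 4) :
    HasSum (fun z : Fin 4 → ℤ => z μ • dressedEntry w 𝒯 ((N : ℤ) • z) a b) 0 := by
  have h1 : ∀ c e : Fin 4, HasSum (fun z : Fin 4 → ℤ => z μ • dressedSum (w c a) (𝒯 c e) (w e b) ((N : ℤ) • z)) 0 := by
    intro c e
    obtain ⟨C, hC⟩ := h.lin c a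
    exact hasSum_dressedSum_first_lattice h.pos (h.const c a) hC (h.const e b) (h.absW c a) (h.absT c e) (h.absW e b)
      (h.T0 c e) μ (h.T1 c e μ)
  have hs := hasSum_sum (s := (Finset.univ : Finset (Fin 4))) fun c _ =>
    hasSum_sum (s := (Finset.univ : Finset (Fin 4))) fun e _ => h1 c e
  simp only [Finset.sum_const_zero] at hs
  simpa only [dressedEntry, Finset.smul_sum] using hs

/-- **ONE STEP OF INHERITANCE**: if the pair `(w j, 𝒯 j)` is admissible and the step kernel `T j` has (T0)/(T1), then the recursion hands (T0)/(T1)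
to `𝒯 (j+1)`. [folklore] -/
theorem wardData_succ_of_stepRecursion {Lc : ℕ} {T 𝒯 : ℕ → EKer 4} {w : ℕ → EKer 4} (hrec : StepRecursion Lc T 𝒯 w)
    {j : ℕ} (hj : 1 ≤ j) (hE : EntryHyps Lc (w j) (𝒯 j)) (hT0 : ∀ c e : Fin 4, HasSum (T j c e) 0)
    (hT1 : ∀ c e μ : Fin 4, HasSum (fun t : Fin 4 → ℤ => t μ • T j c e t) 0) :
    (∀ c e : Fin 4, HasSum (𝒯 (j + 1) c e) 0) ∧ (∀ c e μ : Fin 4, HasSum (fun t : Fin 4 → ℤ => t μ • 𝒯 (j + 1) c e t) 0) := by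
  refine ⟨fun a b => ?_, fun a b μ => ?_⟩
  · have h := ((hasSum_dressedEntry_zero hE a b).mul_left ((Lc : ℝ) ^ 8)).add (hT0 a b)
    rw [mul_zero, zero_add] at h
    exact h.congr_fun fun z => hrec j hj a b z
  · have h := ((hasSum_dressedEntry_first hE a b μ).mul_left ((Lc : ℝ) ^ 8)).add (hT1 a b μ)
    rw [mul_zero, zero_add] at h
    refine h.congr_fun fun z => ?_
    rw [hrec j hj a b z, smul_add]
    simp only [zsmul_eq_mul]
    ring

/-- **ADMISSIBILITY FROM THE STEP KERNELS' WARD DATA.**  Reproduction data of the response weights `w j` (`j ≥ 1`: Kronecker coset masses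
`δ·Lc^{-5}`, affine reproduction, absolutely summable second moments), AbsMoment₂ of the one-shot kernels, (T0)/(T1) of the STEP kernels `T j`
and of `𝒯 1`, and the recursion give `AdmissibleTransport Lc 𝒯 w` — the one-shot kernels' (T0)/(T1) are INHERITED, no separate Ward identities for
them are needed (induction on `j` with `wardData_succ_of_stepRecursion`). [folklore] -/
theorem admissibleTransport_of_stepRecursion {Lc : ℕ} [NeZero Lc] {T 𝒯 : ℕ → EKer 4} {w : ℕ → EKer 4}
    (hwC : ∀ j, 1 ≤ j → ∀ κ l : Fin 4, ConstReproSum Lc (w j κ l) (if κ = l then (((Lc : ℝ) ^ (4 + 1))⁻¹) else 0))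
    (hwL : ∀ j, 1 ≤ j → ∀ κ l : Fin 4, ∃ C : Fin 4 → ℝ, LinReproSum Lc (w j κ l) C)
    (hwA : ∀ j, 1 ≤ j → ∀ κ l : Fin 4, AbsMoment₂ (w j κ l)) (h𝒯A : ∀ m (c e : Fin 4), AbsMoment₂ (𝒯 m c e))
    (hT0 : ∀ j (c e : Fin 4), HasSum (T j c e) 0) (hT1 : ∀ j (c e μ : Fin 4), HasSum (fun t : Fin 4 → ℤ => t μ • T j c e t) 0)
    (h10 : ∀ c e : Fin 4, HasSum (𝒯 1 c e) 0) (h11 : ∀ c e μ : Fin 4, HasSum (fun t : Fin 4 → ℤ => t μ • 𝒯 1 c e t) 0)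
    (hrec : StepRecursion Lc T 𝒯 w) : AdmissibleTransport Lc 𝒯 w := by
  have hpos : 0 < Lc := Nat.pos_of_ne_zero (NeZero.ne Lc)
  have mk : ∀ j, 1 ≤ j → (∀ c e : Fin 4, HasSum (𝒯 j c e) 0) →
      (∀ c e μ : Fin 4, HasSum (fun t : Fin 4 → ℤ => t μ • 𝒯 j c e t) 0) → EntryHyps Lc (w j) (𝒯 j) :=
    fun j hj h0 h1 => ⟨hpos, hwC j hj, hwL j hj, hwA j hj, h𝒯A j, h0, h1⟩
  have key : ∀ j, 1 ≤ j → (∀ c e : Fin 4, HasSum (𝒯 j c e) 0) ∧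
      (∀ c e μ : Fin 4, HasSum (fun t : Fin 4 → ℤ => t μ • 𝒯 j c e t) 0) := by
    intro j hj
    induction j, hj using Nat.le_induction with
    | base => exact ⟨h10, h11⟩
    | succ j hj ih => exact wardData_succ_of_stepRecursion hrec hj (mk j hj ih.1 ih.2) (hT0 j) (hT1 j)
  intro j hj
  exact mk j hj (key j hj).1 (key j hj).2

end Inherit

/-! ## §4 The node's theorem over jet data: `D1Tel` from (R0)–(R2) and the step kernels' Ward data -/

section Node

variable {Lc : ℕ} [NeZero Lc]

/-- **`D1Tel` FROM THE ONE-STEP TRANSPORT RECURSION** (delegated node P6, LAYER 1; binders only, conclusion BY NAME).  For step jet data `Js` and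
composite jet data `Jc`: (T0)/(T1) of the step kernels `TbalOf Lc Js j` (their hTA is `hTA_TbalOf`), (R2) admissible transport of the one-shot
kernels `TshotOf Lc Jc j` through weights `w j` (`j ≥ 1`), (R0) `m2Tensor (TshotOf Lc Jc 1) = m2Tensor (TbalOf Lc Js 0)` and (R1) the one-step
recursion `TshotOf Lc Jc (j+1) a b z = Lc^8 · dressedEntry (w j) (TshotOf Lc Jc j) (Lc•z) a b + TbalOf Lc Js j a b z` (`j ≥ 1`) give
`OneStepKernelFamily.D1Tel Lc Js Jc`. [folklore] -/
theorem d1Tel_of_stepRecursion (Js : ℕ → JetData 3 Lc) (Jc : ∀ m : ℕ, JetData 3 (Lc ^ m)) {w : ℕ → EKer 4}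
    (hT0 : ∀ j (c e : Fin 4), HasSum (TbalOf Lc Js j c e) 0)
    (hT1 : ∀ j (c e ρ : Fin 4), HasSum (fun t : Fin 4 → ℤ => t ρ • TbalOf Lc Js j c e t) 0)
    (hw : AdmissibleTransport Lc (TshotOf Lc Jc) w) (hbase : m2Tensor (TshotOf Lc Jc 1) = m2Tensor (TbalOf Lc Js 0))
    (hrec : StepRecursion Lc (TbalOf Lc Js) (TshotOf Lc Jc) w) : D1Tel Lc Js Jc :=
  hessianTelescoping_of_stepRecursion (hTA_TbalOf Js) hT0 hT1 hw hbase hrec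

/-- The same with the base binder (R0) in KERNEL form `TshotOf Lc Jc 1 = TbalOf Lc Js 0`. [folklore] -/
theorem d1Tel_of_stepRecursion' (Js : ℕ → JetData 3 Lc) (Jc : ∀ m : ℕ, JetData 3 (Lc ^ m)) {w : ℕ → EKer 4}
    (hT0 : ∀ j (c e : Fin 4), HasSum (TbalOf Lc Js j c e) 0)
    (hT1 : ∀ j (c e ρ : Fin 4), HasSum (fun t : Fin 4 → ℤ => t ρ • TbalOf Lc Js j c e t) 0)
    (hw : AdmissibleTransport Lc (TshotOf Lc Jc) w) (hbase : TshotOf Lc Jc 1 = TbalOf Lc Js 0)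
    (hrec : StepRecursion Lc (TbalOf Lc Js) (TshotOf Lc Jc) w) : D1Tel Lc Js Jc :=
  d1Tel_of_stepRecursion Js Jc hT0 hT1 hw (by rw [hbase]) hrec


/-- **THE NODE'S THEOREM WITH THE ONE-SHOT WARD DATA INHERITED** (the form LAYER 2 should target): (T0)/(T1) of the STEP kernels `TbalOf Lc Js j`
(all `j`; beta-an2's `StepJetData` §2 / `KernelWard`), reproduction data of the response weights `w j` (`j ≥ 1`), the base identity
`TshotOf Lc Jc 1 = TbalOf Lc Js 0` and the one-step recursion (R1) give `OneStepKernelFamily.D1Tel Lc Js Jc` — AbsMoment₂ of the one-shot kernels is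
`absMoment₂_TshotOf` BY NAME and their (T0)/(T1) are inherited (§3). [folklore] -/
theorem d1Tel_of_stepRecursion_of_stepWard (Js : ℕ → JetData 3 Lc) (Jc : ∀ m : ℕ, JetData 3 (Lc ^ m)) {w : ℕ → EKer 4}
    (hT0 : ∀ j (c e : Fin 4), HasSum (TbalOf Lc Js j c e) 0)
    (hT1 : ∀ j (c e ρ : Fin 4), HasSum (fun t : Fin 4 → ℤ => t ρ • TbalOf Lc Js j c e t) 0)
    (hwC : ∀ j, 1 ≤ j → ∀ κ l : Fin 4,
      ConstReproSum Lc (w j κ l) (if κ = l then (((Lc : ℝ) ^ (4 + 1))⁻¹) else 0))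
    (hwL : ∀ j, 1 ≤ j → ∀ κ l : Fin 4, ∃ C : Fin 4 → ℝ, LinReproSum Lc (w j κ l) C)
    (hwA : ∀ j, 1 ≤ j → ∀ κ l : Fin 4, AbsMoment₂ (w j κ l))
    (hbase : TshotOf Lc Jc 1 = TbalOf Lc Js 0) (hrec : StepRecursion Lc (TbalOf Lc Js) (TshotOf Lc Jc) w) : D1Tel Lc Js Jc :=
  d1Tel_of_stepRecursion' Js Jc hT0 hT1
    (admissibleTransport_of_stepRecursion hwC hwL hwA (OneStepKernelFamily.absMoment₂_TshotOf Jc) hT0 hT1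
      (fun c e => by rw [hbase]; exact hT0 0 c e) (fun c e μ => by rw [hbase]; exact hT1 0 c e μ) hrec)
    hbase hrec

/-- **CONVERSELY, THE RECURSION COSTS NOTHING AT TENSOR LEVEL**: under the same per-step data, `D1Tel` gives back the one-step identity of
second-moment tensors for every `j ≥ 1` (so LAYER 2 is asked for no more than `D1Tel` needs, up to the kernel-level form of the transport). [folklore] -/
theorem m2Tensor_step_of_d1Tel (Js : ℕ → JetData 3 Lc) (Jc : ∀ m : ℕ, JetData 3 (Lc ^ m))
    (hT0 : ∀ j (c e : Fin 4), HasSum (TbalOf Lc Js j c e) 0)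
    (hT1 : ∀ j (c e ρ : Fin 4), HasSum (fun t : Fin 4 → ℤ => t ρ • TbalOf Lc Js j c e t) 0) (h : D1Tel Lc Js Jc) :
    ∀ j : ℕ, 1 ≤ j → m2Tensor (TshotOf Lc Jc (j + 1)) = m2Tensor (TshotOf Lc Jc j) + m2Tensor (TbalOf Lc Js j) := by
  intro j hj
  have hsum := (hessianTelescoping_iff_m2Tensor_sum (𝒯 := TshotOf Lc Jc) (hTA_TbalOf Js) hT0 hT1).1 h
  rw [hsum (j + 1) (Nat.le_add_left 1 j), hsum j hj, Finset.sum_range_succ]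

end Node

/-! ## §5 Base-case support: the `1`-fold decimation is the identity; the step-`0` kernel -/

section Base

variable {d : ℕ}

/-- The index set of a field leg at `M = 1` is the single index `(0, 0)`. [folklore] -/
theorem legSet_one (c : Fib d) : legSet d 1 c = {(fun _ => 0, 0)} := by
  cases c with
  | inl κ =>
      simp only [legSet, LegIdx, Finset.range_one, Fintype.piFinset_singleton, Finset.singleton_product_singleton]
  | inr _ => rfl

/-- At `M = 1` both leg weights are `1`. [folklore] -/
theorem legW_one (c : Fib d) : legW d 1 c = 1 := by
  cases c <;> simp [legW]

/-- At `M = 1` every leg reads the point itself. [folklore] -/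
theorem legPt_one (c : Fib d) (u : Fin (d + 1) → ℤ) : legPt 1 c u (fun _ => 0, 0) = u := by
  cases c with
  | inl κ => funext i; simp [legPt]
  | inr _ => simp [legPt]

/-- **`dec 1 = id`**: the `1`-fold block-contour decimation reads the kernel (beta-an2 X-an2-32's `m = 1` observation, typed). [folklore] -/
theorem dec_one (K : ExpKernelCalculus.MKer (d + 1) (Fib d)) : dec 1 K = K := by
  funext x y a b
  simp only [dec, legSet_one, Finset.sum_singleton, legW_one, one_mul, legPt_one]

/-- The step-`0` decimated composite resolvent is the one-step packed resolvent at blocking `Lc^1`. [folklore] -/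
theorem kInvStep_zero {Lc : ℕ} [NeZero Lc] : KInvStep (d := d) Lc 0 = KInv (N := Lc ^ 1) (d := d) := by
  unfold KInvStep
  rw [pow_zero]
  exact dec_one _

/-- **THE STEP-`0` KERNEL** is the resolvent Hessian kernel of `KInv (N := Lc^1)` with the chain-rule vertex through its own `ℋ`-column — the
shape of `TshotOf Lc Jc 1 = TOf (N := Lc^1) (Jc 1)` (`OneStepKernelFamily.vertexOfK_KInv`), whence (R0) for composite jets with `Jc 1` = `Js 0`
transported along `Lc^1 = Lc`. [folklore] -/
theorem tbalOf_zero {Lc : ℕ} [NeZero Lc] (Js : ℕ → JetData 3 Lc) :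
    TbalOf Lc Js 0 = hessKer (KInv (N := Lc ^ 1)) (vertexOfK (KInv (N := Lc ^ 1)) Lc (Js 0).S) (Js 0).W := by
  show TstepOf Lc 0 (Js 0) = _
  unfold TstepOf
  rw [kInvStep_zero]

end Base


/-! ## §6 Reproduction data of DILATED patterns and of the `ℋ`-column of `KInvStep`: the weight binders of
`d1Tel_of_stepRecursion_of_stepWard` DISCHARGED for the canonical column weight `wStep` -/

section Column

variable {d : ℕ}

/-- `cosetInd (M·L) (M • v) = cosetInd L v` for `M ≠ 0`. [folklore] -/
theorem cosetInd_mul_zsmul {M : ℕ} (hM : M ≠ 0) (L : ℕ) (v : Fin d → ℤ) :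
    cosetInd (M * L) ((M : ℤ) • v) = cosetInd L v := by
  have hM' : (M : ℤ) ≠ 0 := by exact_mod_cast hM
  have key : (∀ i, ((M * L : ℕ) : ℤ) ∣ ((M : ℤ) • v) i) ↔ ∀ i, (L : ℤ) ∣ v i := by
    refine forall_congr' fun i => ?_
    rw [Nat.cast_mul, Pi.smul_apply, smul_eq_mul]
    exact mul_dvd_mul_iff_left hM'
  unfold cosetInd
  by_cases h : ∀ i, (L : ℤ) ∣ v i
  · rw [if_pos (key.2 h), if_pos h]
  · rw [if_neg (fun h' => h (key.1 h')), if_neg h]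

/-- **DILATION–TRANSLATION REINDEXING OF A COSET-WINDOW SUM**: the `L`-coset sum of `p ↦ φ (c − M•p)` at `a` is the `M·L`-coset sum of
`φ` at `c − M•a` (the map `p ↦ c − M•p` is a bijection of the `L`-coset of `a` onto the `M·L`-coset of `c − M•a`). [folklore] -/
theorem hasSum_cosetWindow_dilate {M L : ℕ} (hM : M ≠ 0) (φ : (Fin d → ℤ) → ℝ) (a c : Fin d → ℤ) {s : ℝ}
    (h : HasSum (fun u : Fin d → ℤ => cosetInd (M * L) ((c - (M : ℤ) • a) - u) • φ u) s) :
    HasSum (fun p : Fin d → ℤ => cosetInd L (a - p) • φ (c - (M : ℤ) • p)) s := by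
  have hg : Function.Injective (fun p : Fin d → ℤ => c - (M : ℤ) • p) := by
    intro p q hpq
    have h' : (M : ℤ) • p = (M : ℤ) • q := sub_right_injective hpq
    exact dilate_injective hM h'
  have hF : ∀ u, u ∉ Set.range (fun p : Fin d → ℤ => c - (M : ℤ) • p) →
      cosetInd (M * L) ((c - (M : ℤ) • a) - u) • φ u = 0 := by
    intro u hu
    rw [cosetInd_eq_zero_of_not_mem_range (M * L) ?_, zero_smul]
    rintro ⟨k, hk⟩
    apply hu
    refine ⟨a + (L : ℤ) • k, ?_⟩
    show c - (M : ℤ) • (a + (L : ℤ) • k) = u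
    have hk' : ((M * L : ℕ) : ℤ) • k = c - (M : ℤ) • a - u := hk
    calc c - (M : ℤ) • (a + (L : ℤ) • k) = (c - (M : ℤ) • a) - ((M * L : ℕ) : ℤ) • k := by
          rw [smul_add, smul_smul, Nat.cast_mul]; abel
      _ = u := by rw [hk']; abel
  have h2 := (hg.hasSum_iff hF).2 h
  refine h2.congr_fun fun p => ?_
  simp only [Function.comp]
  rw [show (c - (M : ℤ) • a) - (c - (M : ℤ) • p) = (M : ℤ) • (p - a) by rw [smul_sub]; abel, cosetInd_mul_zsmul hM,
    cosetInd_sub_comm]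

/-- Constant reproduction is inherited by dilated-translated patterns, with the SAME mass. [folklore] -/
theorem constReproSum_dilate {M L : ℕ} (hM : M ≠ 0) {φ : (Fin d → ℤ) → ℝ} {σ : ℝ} (h : ConstReproSum (M * L) φ σ)
    (c : Fin d → ℤ) : ConstReproSum L (fun p => φ (c - (M : ℤ) • p)) σ :=
  fun a => hasSum_cosetWindow_dilate hM φ a c (h _)

/-- Affine reproduction is inherited by dilated-translated patterns (constants `M⁻¹ (c_μ σ − C_μ)`). [folklore] -/
theorem linReproSum_dilate {M L : ℕ} (hM : M ≠ 0) {φ : (Fin d → ℤ) → ℝ} {σ : ℝ} {C : Fin d → ℝ}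
    (h0 : ConstReproSum (M * L) φ σ) (h1 : LinReproSum (M * L) φ C) (c : Fin d → ℤ) :
    LinReproSum L (fun p => φ (c - (M : ℤ) • p)) (fun μ => ((M : ℝ))⁻¹ * ((c μ : ℝ) * σ - C μ)) := by
  intro a μ
  have hM' : (M : ℝ) ≠ 0 := by exact_mod_cast hM
  have hψ : HasSum (fun u : Fin d → ℤ => cosetInd (M * L) ((c - (M : ℤ) • a) - u) • (((c - u) μ) • φ u))
      ((c μ : ℝ) * σ - C μ) := by
    have e := ((h0 (c - (M : ℤ) • a)).const_smul (c μ)).sub (h1 (c - (M : ℤ) • a) μ)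
    have ev : (c μ : ℤ) • σ - C μ = (c μ : ℝ) * σ - C μ := by rw [zsmul_eq_mul]
    rw [ev] at e
    refine e.congr_fun fun u => ?_
    simp only [zsmul_eq_mul, Int.cast_sub, Int.cast_mul, Pi.sub_apply]
    ring
  have hr := (hasSum_cosetWindow_dilate hM (fun u => ((c - u) μ) • φ u) a c hψ).mul_left ((M : ℝ)⁻¹)
  refine hr.congr_fun fun p => ?_
  have hz : (((M : ℤ) • p) μ : ℤ) = (M : ℤ) * p μ := by rw [Pi.smul_apply, smul_eq_mul]
  rw [sub_sub_cancel, hz]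
  simp only [zsmul_eq_mul, Int.cast_mul, Int.cast_natCast]
  field_simp

/-- Scaling a pattern scales its coset masses. [folklore] -/
theorem constReproSum_const_mul {N : ℕ} {f : (Fin d → ℤ) → ℝ} {σ : ℝ} (h : ConstReproSum N f σ) (r : ℝ) :
    ConstReproSum N (fun p => r * f p) (r * σ) :=
  fun a => ((h a).mul_left r).congr_fun fun p => by simp only [zsmul_eq_mul]; ring

/-- Scaling a pattern scales its windowed first moments. [folklore] -/
theorem linReproSum_const_mul {N : ℕ} {f : (Fin d → ℤ) → ℝ} {C : Fin d → ℝ} (h : LinReproSum N f C) (r : ℝ) :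
    LinReproSum N (fun p => r * f p) (fun μ => r * C μ) :=
  fun a μ => ((h a μ).mul_left r).congr_fun fun p => by simp only [zsmul_eq_mul]; ring

/-- Scaling preserves absolutely summable second moments. [folklore] -/
theorem absMoment₂_const_mul' {f : (Fin d → ℤ) → ℝ} (hf : AbsMoment₂ f) (r : ℝ) : AbsMoment₂ (fun z => r * f z) := by
  unfold AbsMoment₂ at hf ⊢
  refine (hf.mul_left |r|).congr fun z => ?_
  rw [abs_mul]; ring

variable {Lc : ℕ} [NeZero Lc]

/-- The block offset of a field-leg index: `r + s e_κ`. [folklore] -/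
def legOff (κ : Fin (d + 1)) (i : (Fin (d + 1) → ℕ) × ℕ) : Fin (d + 1) → ℤ :=
  fun j => ((i.1 j : ℤ) + if j = κ then (i.2 : ℤ) else 0)

/-- **THE `ℋ`-COLUMN PATTERN OF THE DECIMATED COMPOSITE RESOLVENT**: `stepCol Lc j κ l p := KInvStep Lc j (−p) 0 (inl κ) (inr l)` — the
decimated fine-field response of type `κ` at step-`j` relative position `−p` to the multiplier source of type `l` at the coarse origin.
[folklore] -/
def stepCol (Lc : ℕ) [NeZero Lc] (j : ℕ) (κ l : Fin (d + 1)) (p : Fin (d + 1) → ℤ) : ℝ :=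
  KInvStep (d := d) Lc j (-p) 0 (Sum.inl κ) (Sum.inr l)

/-- `KInv x 0 (inl κ) (inr l) = wH κ l x`. [folklore] -/
theorem KInv_inl_inr_zero {N : ℕ} [NeZero N] (κ l : Fin (d + 1)) (x : Fin (d + 1) → ℤ) :
    KInv (N := N) x 0 (Sum.inl κ) (Sum.inr l) = wH (N := N) κ l x := by
  have h := KInv_inl_inr_coarse (N := N) κ l x 0
  simp only [smul_zero, sub_zero] at h
  exact h

/-- UNFOLDING: the column is the block-contour MEAN (weights `(Lc^j)^{−(d+2)}`) of the `(j+1)`-level kernel `wH` over the leg offsets,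
read at `legOff κ i − Lc^j • p`. [folklore] -/
theorem stepCol_eq (j : ℕ) (κ l : Fin (d + 1)) (p : Fin (d + 1) → ℤ) :
    stepCol (d := d) Lc j κ l p = ∑ i ∈ LegIdx d (Lc ^ j),
      (((Lc ^ j : ℕ) : ℝ) ^ (d + 2))⁻¹ * wH (N := Lc ^ (j + 1)) κ l (legOff κ i - ((Lc ^ j : ℕ) : ℤ) • p) := by
  unfold stepCol KInvStep dec
  simp only [legSet, legW, legPt, Finset.sum_singleton, mul_one, smul_zero, KInv_inl_inr_zero, smul_neg]
  refine Finset.sum_congr rfl fun i _ => ?_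
  rw [neg_add_eq_sub]
  rfl

/-- **CONSTANT REPRODUCTION OF THE COLUMN THROUGH `Lc•ℤ^{d+1}` WITH THE MASS OF THE FINE KERNEL**: the `Lc`-coset sums of `stepCol Lc j κ l`
are `δ_{κl} · (Lc^{j+1})^{−(d+2)}` — decimation by `Lc^j` averages `(Lc^j)^{d+2}` fine cosets of `wH_{Lc^{j+1}}`, each of Kronecker mass
`(Lc^{j+1})^{−(d+2)}` (`KernelSpecInstance.lowMomentsSum_specK`), with weights `(Lc^j)^{−(d+2)}`.  (For `d = 3` this is the count
`σ_j = δ · Lc^{−5j−5}` of cell finding X-an4-37: the RAW column is NOT an admissible transport weight at blocking `Lc` for `j ≥ 1`; the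
normalised column `wStep` below is.) [folklore] -/
theorem constReproSum_stepCol (j : ℕ) (κ l : Fin (d + 1)) :
    ConstReproSum Lc (stepCol (d := d) Lc j κ l) (if κ = l then ((((Lc ^ (j + 1) : ℕ) : ℝ)) ^ (d + 1 + 1))⁻¹ else 0) := by
  intro a
  have hM : Lc ^ j ≠ 0 := pow_ne_zero _ (NeZero.ne Lc)
  have hw : ConstReproSum (Lc ^ j * Lc) (wH (N := Lc ^ (j + 1)) κ l)
      (if κ = l then ((((Lc ^ (j + 1) : ℕ) : ℝ)) ^ (d + 1 + 1))⁻¹ else 0) := by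
    rw [← pow_succ]
    exact (lowMomentsSum_specK (N := Lc ^ (j + 1))).1 κ l
  have hleg : ∀ i ∈ LegIdx d (Lc ^ j), HasSum (fun p : Fin (d + 1) → ℤ => cosetInd Lc (a - p) •
      ((((Lc ^ j : ℕ) : ℝ) ^ (d + 2))⁻¹ * wH (N := Lc ^ (j + 1)) κ l (legOff κ i - ((Lc ^ j : ℕ) : ℤ) • p)))
      ((((Lc ^ j : ℕ) : ℝ) ^ (d + 2))⁻¹ * (if κ = l then ((((Lc ^ (j + 1) : ℕ) : ℝ)) ^ (d + 1 + 1))⁻¹ else 0)) := by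
    intro i _
    refine ((constReproSum_dilate hM hw (legOff κ i) a).mul_left ((((Lc ^ j : ℕ) : ℝ) ^ (d + 2))⁻¹)).congr_fun fun p => ?_
    simp only [zsmul_eq_mul]
    ring
  have hs := hasSum_sum hleg
  have h1 : ∑ _i ∈ LegIdx d (Lc ^ j), (((Lc ^ j : ℕ) : ℝ) ^ (d + 2))⁻¹ = 1 := by
    have := sum_legW (d := d) hM (Sum.inl κ)
    simpa only [legSet, legW] using this
  rw [← Finset.sum_mul, h1, one_mul] at hs
  refine hs.congr_fun fun p => ?_
  rw [stepCol_eq, Finset.smul_sum]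

/-- **AFFINE REPRODUCTION OF THE COLUMN THROUGH `Lc•ℤ^{d+1}`** (some coset-independent constants). [folklore] -/
theorem linReproSum_stepCol (j : ℕ) (κ l : Fin (d + 1)) : ∃ C : Fin (d + 1) → ℝ, LinReproSum Lc (stepCol (d := d) Lc j κ l) C := by
  have hM : Lc ^ j ≠ 0 := pow_ne_zero _ (NeZero.ne Lc)
  set σ0 : ℝ := (if κ = l then ((((Lc ^ (j + 1) : ℕ) : ℝ)) ^ (d + 1 + 1))⁻¹ else 0) with hσ0
  have hw : ConstReproSum (Lc ^ j * Lc) (wH (N := Lc ^ (j + 1)) κ l) σ0 := by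
    rw [hσ0, ← pow_succ]
    exact (lowMomentsSum_specK (N := Lc ^ (j + 1))).1 κ l
  obtain ⟨C', hC'0⟩ := (lowMomentsSum_specK (N := Lc ^ (j + 1))).2 κ l
  have hC' : LinReproSum (Lc ^ j * Lc) (wH (N := Lc ^ (j + 1)) κ l) C' := by
    rw [← pow_succ]
    exact hC'0
  refine ⟨fun μ => ∑ i ∈ LegIdx d (Lc ^ j), (((Lc ^ j : ℕ) : ℝ) ^ (d + 2))⁻¹ *
    ((((Lc ^ j : ℕ) : ℝ))⁻¹ * (((legOff κ i μ : ℤ) : ℝ) * σ0 - C' μ)), fun a μ => ?_⟩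
  have hleg : ∀ i ∈ LegIdx d (Lc ^ j), HasSum (fun p : Fin (d + 1) → ℤ => (cosetInd Lc (a - p) * p μ) •
      ((((Lc ^ j : ℕ) : ℝ) ^ (d + 2))⁻¹ * wH (N := Lc ^ (j + 1)) κ l (legOff κ i - ((Lc ^ j : ℕ) : ℤ) • p)))
      ((((Lc ^ j : ℕ) : ℝ) ^ (d + 2))⁻¹ * ((((Lc ^ j : ℕ) : ℝ))⁻¹ * (((legOff κ i μ : ℤ) : ℝ) * σ0 - C' μ))) := by
    intro i _
    refine (((linReproSum_dilate hM hw hC' (legOff κ i)) a μ).mul_left ((((Lc ^ j : ℕ) : ℝ) ^ (d + 2))⁻¹)).congr_fun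
      fun p => ?_
    simp only [zsmul_eq_mul, Int.cast_mul]
    ring
  have hs := hasSum_sum hleg
  refine hs.congr_fun fun p => ?_
  rw [stepCol_eq, Finset.smul_sum]

/-- The column has absolutely summable second moments (exponential decay of `KInvStep`). [folklore] -/
theorem absMoment₂_stepCol (j : ℕ) (κ l : Fin (d + 1)) : AbsMoment₂ (stepCol (d := d) Lc j κ l) := by
  obtain ⟨δ, C, hδ, _, hK⟩ := decays_KInvStep (d := d) (Lc := Lc) j
  refine absMoment₂_of_decay510 hδ (C := C) fun p => ?_
  have h := hK (-p) 0 (Sum.inl κ) (Sum.inr l)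
  rw [sub_zero, l1_neg_eq] at h
  exact h

/-- **THE CANONICAL TRANSPORT WEIGHT** (`d = 3`): the `ℋ`-column of `KInvStep Lc j` RENORMALISED by `Lc^{5j}` so that its `Lc`-coset
Kronecker mass is `Lc^{−5}` — the admissible normalisation of `DressedMomentNormalisation.EntryHyps` at blocking `Lc` (second moments
are then transported unchanged through the `Lc^8 · dressedEntry` of `StepRecursion`; X-an4-37 §3).  This IS beta-an2's declared bond-unit
convention for the composite jets `JcRec` (journal ANSWER (A2), l.53794: `w j c a p := (Lc:ℝ)^((d+2)·j) * KInvStep Lc j (−p) 0 (inl c) (inr a)`,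
`d = 3`), to be consumed BY NAME. [folklore] -/
def wStep (Lc : ℕ) [NeZero Lc] (j : ℕ) : EKer 4 := fun κ l p => (Lc : ℝ) ^ (5 * j) * stepCol (d := 3) Lc j κ l p

/-- (L0∞) for `wStep`: Kronecker coset mass `Lc^{−5}`, at EVERY step `j`. [folklore] -/
theorem constReproSum_wStep (j : ℕ) (κ l : Fin 4) :
    ConstReproSum Lc (wStep Lc j κ l) (if κ = l then (((Lc : ℝ) ^ (4 + 1))⁻¹) else 0) := by
  have hL : (Lc : ℝ) ≠ 0 := by exact_mod_cast (NeZero.ne Lc)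
  have h := constReproSum_const_mul (constReproSum_stepCol (d := 3) (Lc := Lc) j κ l) ((Lc : ℝ) ^ (5 * j))
  have ev : (Lc : ℝ) ^ (5 * j) * (if κ = l then ((((Lc ^ (j + 1) : ℕ) : ℝ)) ^ (3 + 1 + 1))⁻¹ else 0)
      = (if κ = l then (((Lc : ℝ) ^ (4 + 1))⁻¹) else 0) := by
    split_ifs
    · push_cast
      have e : ((Lc : ℝ) ^ (j + 1)) ^ (3 + 1 + 1) = (Lc : ℝ) ^ (5 * j) * (Lc : ℝ) ^ (4 + 1) := by ring
      rw [e, mul_inv, ← mul_assoc, mul_inv_cancel₀ (pow_ne_zero _ hL), one_mul]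
    · rw [mul_zero]
  rw [ev] at h
  exact h

/-- (L1∞) for `wStep`. [folklore] -/
theorem linReproSum_wStep (j : ℕ) (κ l : Fin 4) : ∃ C : Fin 4 → ℝ, LinReproSum Lc (wStep Lc j κ l) C := by
  obtain ⟨C, hC⟩ := linReproSum_stepCol (d := 3) (Lc := Lc) j κ l
  exact ⟨_, linReproSum_const_mul hC ((Lc : ℝ) ^ (5 * j))⟩

/-- AbsMoment₂ for `wStep`. [folklore] -/
theorem absMoment₂_wStep (j : ℕ) (κ l : Fin 4) : AbsMoment₂ (wStep Lc j κ l) :=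
  absMoment₂_const_mul' (absMoment₂_stepCol (d := 3) (Lc := Lc) j κ l) ((Lc : ℝ) ^ (5 * j))

/-- **THE NODE'S THEOREM FOR THE CANONICAL WEIGHT** — what LAYER 2 has to supply is now EXACTLY: (T0)/(T1) of the step kernels, the base
identity, and the one-step recursion (R1) with the canonical weight `wStep Lc`; all weight-side binders of
`d1Tel_of_stepRecursion_of_stepWard` are discharged by §6. [folklore] -/
theorem d1Tel_of_stepRecursion_wStep (Js : ℕ → JetData 3 Lc) (Jc : ∀ m : ℕ, JetData 3 (Lc ^ m))
    (hT0 : ∀ j (c e : Fin 4), HasSum (TbalOf Lc Js j c e) 0)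
    (hT1 : ∀ j (c e ρ : Fin 4), HasSum (fun t : Fin 4 → ℤ => t ρ • TbalOf Lc Js j c e t) 0)
    (hbase : TshotOf Lc Jc 1 = TbalOf Lc Js 0) (hrec : StepRecursion Lc (TbalOf Lc Js) (TshotOf Lc Jc) (wStep Lc)) :
    D1Tel Lc Js Jc :=
  d1Tel_of_stepRecursion_of_stepWard Js Jc hT0 hT1 (fun j _ κ l => constReproSum_wStep j κ l)
    (fun j _ κ l => linReproSum_wStep j κ l) (fun j _ κ l => absMoment₂_wStep j κ l) hbase hrec

end Column

/-! ## §7 (v1.3) The recursion MODULO A REMAINDER: sockets for P6c «LongitudinalCancellation» at the kernel-entry,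
second-moment and read-out level (RULING (R26-2) of the β sub-cell lead, journal l.54484) -/

section Remainder


/-- **THE ONE-STEP RECURSION UP TO AN EXPLICIT CORRECTION FAMILY** `R : ℕ → EKer 4`: for every `j ≥ 1` and every coarse bond pair,
`𝒯 (j+1) a b z = Lc^8 · dressedEntry (w j) (𝒯 j) (Lc•z) a b + T j a b z + R j a b z`.  For Bałaban's data (RULING (R26-2) of the β sub-cell
lead): `R j` = the longitudinal contact term of the KKT composition within one gauge slice; `R = 0` is the kernel-entry form of P6c
(`stepRecursionUpTo_zero_iff`).  `R 0` never enters.  A PREDICATE over the four families — LAYER 2's, never a fact. [folklore] -/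
def StepRecursionUpTo (Lc : ℕ) (T 𝒯 : ℕ → EKer 4) (w R : ℕ → EKer 4) : Prop :=
  ∀ j : ℕ, 1 ≤ j → ∀ (a b : Fin 4) (z : Fin 4 → ℤ),
    𝒯 (j + 1) a b z = (Lc : ℝ) ^ 8 * dressedEntry (w j) (𝒯 j) ((Lc : ℤ) • z) a b + T j a b z + R j a b z

/-- **THE STEP DEFECT** of the pair of families w.r.t. the transport `w`: `𝒯 (j+1) − (Lc^8 · dressed_{w j} 𝒯 j ∘ (Lc•·) + T j)`. [folklore] -/
def stepDefect (Lc : ℕ) (T 𝒯 : ℕ → EKer 4) (w : ℕ → EKer 4) (j : ℕ) : EKer 4 := fun a b z =>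
  𝒯 (j + 1) a b z - ((Lc : ℝ) ^ 8 * dressedEntry (w j) (𝒯 j) ((Lc : ℤ) • z) a b + T j a b z)

/-- The recursion modulo its own defect holds FOR FREE — every bit of content of `StepRecursionUpTo` is in the hypotheses later put on `R`.
[folklore] -/
theorem stepRecursionUpTo_stepDefect (Lc : ℕ) (T 𝒯 : ℕ → EKer 4) (w : ℕ → EKer 4) :
    StepRecursionUpTo Lc T 𝒯 w (stepDefect Lc T 𝒯 w) := by
  intro j _ a b z
  simp only [stepDefect]
  ring

/-- Zero remainder = the recursion (R1) of §2 (P6c at the KERNEL-ENTRY level). [folklore] -/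
theorem stepRecursionUpTo_zero_iff {Lc : ℕ} {T 𝒯 : ℕ → EKer 4} {w : ℕ → EKer 4} :
    StepRecursionUpTo Lc T 𝒯 w (fun _ => 0) ↔ StepRecursion Lc T 𝒯 w := by
  simp only [StepRecursionUpTo, StepRecursion, Pi.zero_apply, add_zero]

/-- (R1) ⟺ the step defect vanishes at every `j ≥ 1`. [folklore] -/
theorem stepRecursion_iff_stepDefect_eq_zero {Lc : ℕ} {T 𝒯 : ℕ → EKer 4} {w : ℕ → EKer 4} :
    StepRecursion Lc T 𝒯 w ↔ ∀ j : ℕ, 1 ≤ j → stepDefect Lc T 𝒯 w j = 0 := by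
  refine ⟨fun h j hj => ?_, fun h j hj a b z => ?_⟩
  · funext a b z
    simp only [stepDefect, Pi.zero_apply, h j hj a b z, sub_self]
  · have e := congrFun (congrFun (congrFun (h j hj) a) b) z
    simp only [stepDefect, Pi.zero_apply] at e
    exact sub_eq_zero.mp e

/-- A remainder is a MODIFIED STEP FAMILY: `StepRecursionUpTo … T … R` is `StepRecursion` for the step kernels `T j + R j`. [folklore] -/
theorem stepRecursionUpTo_iff_stepRecursion_add {Lc : ℕ} {T 𝒯 : ℕ → EKer 4} {w R : ℕ → EKer 4} :
    StepRecursionUpTo Lc T 𝒯 w R ↔ StepRecursion Lc (fun j a b z => T j a b z + R j a b z) 𝒯 w := by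
  simp only [StepRecursionUpTo, StepRecursion, add_assoc]

/-- **ONE STEP AT TENSOR LEVEL, WITH REMAINDER**: under hTA of `T`, absolutely summable second moments of `R j` (`j ≥ 1`), admissible
transport and the recursion modulo `R`, `m2Tensor (𝒯 (j+1)) = m2Tensor (𝒯 j) + m2Tensor (T j) + m2Tensor (R j)` for every `j ≥ 1`. [folklore] -/
theorem m2Tensor_step_of_stepRecursionUpTo {Lc : ℕ} {T 𝒯 : ℕ → EKer 4} {w R : ℕ → EKer 4}
    (hTA : ∀ j (c e : Fin 4), AbsMoment₂ (T j c e)) (hRA : ∀ j, 1 ≤ j → ∀ c e : Fin 4, AbsMoment₂ (R j c e))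
    (hw : AdmissibleTransport Lc 𝒯 w) (hrec : StepRecursionUpTo Lc T 𝒯 w R) :
    ∀ j : ℕ, 1 ≤ j → m2Tensor (𝒯 (j + 1)) = m2Tensor (𝒯 j) + m2Tensor (T j) + m2Tensor (R j) := by
  intro j hj
  funext κ lam a b
  have hA := hasSum_transport_m2Tensor (hw j hj) κ lam a b
  have hB : Summable (fun t : Fin 4 → ℤ => (t κ * t lam) • T j a b t) :=
    summable_smul_of_absMoment₂ (hTA j a b) (IsMoment₂.coord2 κ lam)
  have hC : Summable (fun t : Fin 4 → ℤ => (t κ * t lam) • R j a b t) :=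
    summable_smul_of_absMoment₂ (hRA j hj a b) (IsMoment₂.coord2 κ lam)
  show m2Tensor (𝒯 (j + 1)) κ lam a b = m2Tensor (𝒯 j) κ lam a b + m2Tensor (T j) κ lam a b + m2Tensor (R j) κ lam a b
  calc m2Tensor (𝒯 (j + 1)) κ lam a b
      = ∑' t : Fin 4 → ℤ, (((t κ * t lam) • ((Lc : ℝ) ^ 8 * dressedEntry (w j) (𝒯 j) ((Lc : ℤ) • t) a b)
          + (t κ * t lam) • T j a b t) + (t κ * t lam) • R j a b t) := by
        simp only [m2Tensor]
        exact tsum_congr fun t => by rw [hrec j hj a b t, smul_add, smul_add]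
    _ = m2Tensor (𝒯 j) κ lam a b + m2Tensor (T j) κ lam a b + m2Tensor (R j) κ lam a b := by
        rw [Summable.tsum_add (hA.summable.add hB) hC, Summable.tsum_add hA.summable hB, hA.tsum_eq]
        rfl

/-- **ONE STEP OF INHERITANCE, WITH REMAINDER**: if `(w j, 𝒯 j)` is admissible, the step kernel `T j` has (T0)/(T1) and the remainder `R j` has
vanishing zeroth and first decimated moments, then `𝒯 (j+1)` has (T0)/(T1). [folklore] -/
theorem wardData_succ_of_stepRecursionUpTo {Lc : ℕ} {T 𝒯 : ℕ → EKer 4} {w R : ℕ → EKer 4} (hrec : StepRecursionUpTo Lc T 𝒯 w R)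
    {j : ℕ} (hj : 1 ≤ j) (hE : EntryHyps Lc (w j) (𝒯 j)) (hT0 : ∀ c e : Fin 4, HasSum (T j c e) 0)
    (hT1 : ∀ c e μ : Fin 4, HasSum (fun t : Fin 4 → ℤ => t μ • T j c e t) 0) (hR0 : ∀ c e : Fin 4, HasSum (R j c e) 0)
    (hR1 : ∀ c e μ : Fin 4, HasSum (fun t : Fin 4 → ℤ => t μ • R j c e t) 0) :
    (∀ c e : Fin 4, HasSum (𝒯 (j + 1) c e) 0) ∧ (∀ c e μ : Fin 4, HasSum (fun t : Fin 4 → ℤ => t μ • 𝒯 (j + 1) c e t) 0) := by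
  refine ⟨fun a b => ?_, fun a b μ => ?_⟩
  · have h := (((hasSum_dressedEntry_zero hE a b).mul_left ((Lc : ℝ) ^ 8)).add (hT0 a b)).add (hR0 a b)
    rw [mul_zero, zero_add, zero_add] at h
    exact h.congr_fun fun z => hrec j hj a b z
  · have h := (((hasSum_dressedEntry_first hE a b μ).mul_left ((Lc : ℝ) ^ 8)).add (hT1 a b μ)).add (hR1 a b μ)
    rw [mul_zero, zero_add, zero_add] at h
    refine h.congr_fun fun z => ?_
    rw [hrec j hj a b z, smul_add, smul_add]
    simp only [zsmul_eq_mul]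
    ring

/-- **ADMISSIBILITY FROM THE STEP KERNELS' AND THE REMAINDERS' WARD DATA** (induction on `j`, as `admissibleTransport_of_stepRecursion` with the
remainder's zeroth/first moments added at every `j ≥ 1`). [folklore] -/
theorem admissibleTransport_of_stepRecursionUpTo {Lc : ℕ} [NeZero Lc] {T 𝒯 : ℕ → EKer 4} {w R : ℕ → EKer 4}
    (hwC : ∀ j, 1 ≤ j → ∀ κ l : Fin 4, ConstReproSum Lc (w j κ l) (if κ = l then (((Lc : ℝ) ^ (4 + 1))⁻¹) else 0))
    (hwL : ∀ j, 1 ≤ j → ∀ κ l : Fin 4, ∃ C : Fin 4 → ℝ, LinReproSum Lc (w j κ l) C)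
    (hwA : ∀ j, 1 ≤ j → ∀ κ l : Fin 4, AbsMoment₂ (w j κ l)) (h𝒯A : ∀ m (c e : Fin 4), AbsMoment₂ (𝒯 m c e))
    (hT0 : ∀ j (c e : Fin 4), HasSum (T j c e) 0) (hT1 : ∀ j (c e μ : Fin 4), HasSum (fun t : Fin 4 → ℤ => t μ • T j c e t) 0)
    (hR0 : ∀ j, 1 ≤ j → ∀ c e : Fin 4, HasSum (R j c e) 0)
    (hR1 : ∀ j, 1 ≤ j → ∀ c e μ : Fin 4, HasSum (fun t : Fin 4 → ℤ => t μ • R j c e t) 0)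
    (h10 : ∀ c e : Fin 4, HasSum (𝒯 1 c e) 0) (h11 : ∀ c e μ : Fin 4, HasSum (fun t : Fin 4 → ℤ => t μ • 𝒯 1 c e t) 0)
    (hrec : StepRecursionUpTo Lc T 𝒯 w R) : AdmissibleTransport Lc 𝒯 w := by
  have hpos : 0 < Lc := Nat.pos_of_ne_zero (NeZero.ne Lc)
  have mk : ∀ j, 1 ≤ j → (∀ c e : Fin 4, HasSum (𝒯 j c e) 0) →
      (∀ c e μ : Fin 4, HasSum (fun t : Fin 4 → ℤ => t μ • 𝒯 j c e t) 0) → EntryHyps Lc (w j) (𝒯 j) :=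
    fun j hj h0 h1 => ⟨hpos, hwC j hj, hwL j hj, hwA j hj, h𝒯A j, h0, h1⟩
  have key : ∀ j, 1 ≤ j → (∀ c e : Fin 4, HasSum (𝒯 j c e) 0) ∧
      (∀ c e μ : Fin 4, HasSum (fun t : Fin 4 → ℤ => t μ • 𝒯 j c e t) 0) := by
    intro j hj
    induction j, hj using Nat.le_induction with
    | base => exact ⟨h10, h11⟩
    | succ j hj ih =>
        exact wardData_succ_of_stepRecursionUpTo hrec hj (mk j hj ih.1 ih.2) (hT0 j) (hT1 j) (hR0 j hj) (hR1 j hj)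
  intro j hj
  exact mk j hj (key j hj).1 (key j hj).2

/-- **HESSIAN TELESCOPING FROM THE RECURSION MODULO A REMAINDER INVISIBLE AT THE SECOND-MOMENT LEVEL** (abstract families): per-step data of
`T`, absolutely summable second moments and VANISHING SECOND-MOMENT TENSORS of the remainders `R j` (`j ≥ 1`) — P6c at the second-moment
level —, admissible transport, the base identity and the recursion modulo `R` give `HessianTelescoping Lc T 𝒯`. [folklore] -/
theorem hessianTelescoping_of_stepRecursionUpTo {Lc : ℕ} [NeZero Lc] {T 𝒯 : ℕ → EKer 4} {w R : ℕ → EKer 4}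
    (hTA : ∀ j (c e : Fin 4), AbsMoment₂ (T j c e)) (hT0 : ∀ j (c e : Fin 4), HasSum (T j c e) 0)
    (hT1 : ∀ j (c e ρ : Fin 4), HasSum (fun t : Fin 4 → ℤ => t ρ • T j c e t) 0)
    (hRA : ∀ j, 1 ≤ j → ∀ c e : Fin 4, AbsMoment₂ (R j c e)) (hR2 : ∀ j, 1 ≤ j → m2Tensor (R j) = 0)
    (hw : AdmissibleTransport Lc 𝒯 w) (hbase : m2Tensor (𝒯 1) = m2Tensor (T 0)) (hrec : StepRecursionUpTo Lc T 𝒯 w R) :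
    HessianTelescoping Lc T 𝒯 :=
  (hessianTelescoping_iff_m2Tensor_sum hTA hT0 hT1).2
    (m2Tensor_eq_sum_of_step hbase fun j hj => by
      rw [m2Tensor_step_of_stepRecursionUpTo hTA hRA hw hrec j hj, hR2 j hj, add_zero])

/-- **READ-OUT ADDITIVITY BY INDUCTION** (bookkeeping, any `F`): a base identity at `m = 1` and a one-step identity of READ-OUTS give
`F (m2Tensor (𝒯 m)) = Σ_{j<m} F (m2Tensor (T j))` for every `m ≥ 1`. [folklore] -/
theorem readout_eq_sum_of_step {T 𝒯 : ℕ → EKer 4} {F : Beta.HidentScalewise.Tensor4 → ℝ} (hbase : F (m2Tensor (𝒯 1)) = F (m2Tensor (T 0)))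
    (hstep : ∀ j : ℕ, 1 ≤ j → F (m2Tensor (𝒯 (j + 1))) = F (m2Tensor (𝒯 j)) + F (m2Tensor (T j))) :
    ∀ m : ℕ, 1 ≤ m → F (m2Tensor (𝒯 m)) = ∑ j ∈ range m, F (m2Tensor (T j)) := by
  intro m hm
  induction m, hm using Nat.le_induction with
  | base => rw [Finset.sum_range_one, hbase]
  | succ m hm ih => rw [hstep m hm, ih, Finset.sum_range_succ]

/-- **READ-OUT TELESCOPING FROM THE RECURSION MODULO A REMAINDER INVISIBLE AT THE READ-OUT LEVEL**: for an ADDITIVE read-out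
`F : HidentScalewise.Tensor4 → ℝ` (e.g. `ScalewiseVectorSeam.readout122 μ ν`, `μ ≠ ν`), per-step hTA of `T`, absolutely summable second moments of the
remainders and `F (m2Tensor (R j)) = 0` (`j ≥ 1`) — P6c AT THE READ-OUT LEVEL —, admissible transport, the base identity of read-outs and the
recursion modulo `R` give `F (m2Tensor (𝒯 m)) = Σ_{j<m} F (m2Tensor (T j))` for every `m ≥ 1`: the identity EXIT-B reads
(`HidentScalewise.flowSum_eq_oneShotReadout`, with `β⁰_j := F (m2Tensor (T j))`). [folklore] -/
theorem readout_sum_of_stepRecursionUpTo {Lc : ℕ} {T 𝒯 : ℕ → EKer 4} {w R : ℕ → EKer 4} {F : Beta.HidentScalewise.Tensor4 → ℝ}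
    (hFadd : ∀ A B, F (A + B) = F A + F B) (hTA : ∀ j (c e : Fin 4), AbsMoment₂ (T j c e))
    (hRA : ∀ j, 1 ≤ j → ∀ c e : Fin 4, AbsMoment₂ (R j c e)) (hRF : ∀ j, 1 ≤ j → F (m2Tensor (R j)) = 0)
    (hw : AdmissibleTransport Lc 𝒯 w) (hbase : F (m2Tensor (𝒯 1)) = F (m2Tensor (T 0))) (hrec : StepRecursionUpTo Lc T 𝒯 w R) :
    ∀ m : ℕ, 1 ≤ m → F (m2Tensor (𝒯 m)) = ∑ j ∈ range m, F (m2Tensor (T j)) :=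
  readout_eq_sum_of_step hbase fun j hj => by
    rw [m2Tensor_step_of_stepRecursionUpTo hTA hRA hw hrec j hj, hFadd, hFadd, hRF j hj, add_zero]

end Remainder

/-! ## §8 (v1.3) The node's theorems MODULO A REMAINDER over jet data, canonical weight `wStep` -/

section NodeRemainder


variable {Lc : ℕ} [NeZero Lc]

/-- **`D1Tel` FROM THE RECURSION MODULO A REMAINDER, ONE-SHOT WARD DATA SUPPLIED** (as `AdmissibleTransport`): (T0)/(T1) of the step kernels,
(R2), absolutely summable second moments and vanishing second-moment tensors of the remainders (`j ≥ 1`), the base identity and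
`StepRecursionUpTo` give `D1Tel Lc Js Jc`. [folklore] -/
theorem d1Tel_of_stepRecursionUpTo (Js : ℕ → JetData 3 Lc) (Jc : ∀ m : ℕ, JetData 3 (Lc ^ m)) {w R : ℕ → EKer 4}
    (hT0 : ∀ j (c e : Fin 4), HasSum (TbalOf Lc Js j c e) 0)
    (hT1 : ∀ j (c e ρ : Fin 4), HasSum (fun t : Fin 4 → ℤ => t ρ • TbalOf Lc Js j c e t) 0)
    (hw : AdmissibleTransport Lc (TshotOf Lc Jc) w) (hRA : ∀ j, 1 ≤ j → ∀ c e : Fin 4, AbsMoment₂ (R j c e))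
    (hR2 : ∀ j, 1 ≤ j → m2Tensor (R j) = 0) (hbase : TshotOf Lc Jc 1 = TbalOf Lc Js 0)
    (hrec : StepRecursionUpTo Lc (TbalOf Lc Js) (TshotOf Lc Jc) w R) : D1Tel Lc Js Jc :=
  hessianTelescoping_of_stepRecursionUpTo (hTA_TbalOf Js) hT0 hT1 hRA hR2 hw (by rw [hbase]) hrec

/-- **THE NODE'S THEOREM FOR THE CANONICAL WEIGHT, MODULO A REMAINDER INVISIBLE AT THE SECOND-MOMENT LEVEL** — the socket for P6c at the
second-moment level: (T0)/(T1) of the step kernels `TbalOf Lc Js j`; for the remainders `R j` (`j ≥ 1`) vanishing zeroth and first decimated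
moments (so that the one-shot kernels' Ward data are inherited, §7), absolutely summable second moments and VANISHING SECOND-MOMENT TENSOR;
the base identity; and (R1) modulo `R` with `w = wStep Lc`.  Conclusion `OneStepKernelFamily.D1Tel Lc Js Jc` BY NAME. [folklore] -/
theorem d1Tel_of_stepRecursionUpTo_wStep (Js : ℕ → JetData 3 Lc) (Jc : ∀ m : ℕ, JetData 3 (Lc ^ m)) {R : ℕ → EKer 4}
    (hT0 : ∀ j (c e : Fin 4), HasSum (TbalOf Lc Js j c e) 0)
    (hT1 : ∀ j (c e ρ : Fin 4), HasSum (fun t : Fin 4 → ℤ => t ρ • TbalOf Lc Js j c e t) 0)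
    (hR0 : ∀ j, 1 ≤ j → ∀ c e : Fin 4, HasSum (R j c e) 0)
    (hR1 : ∀ j, 1 ≤ j → ∀ c e ρ : Fin 4, HasSum (fun t : Fin 4 → ℤ => t ρ • R j c e t) 0)
    (hRA : ∀ j, 1 ≤ j → ∀ c e : Fin 4, AbsMoment₂ (R j c e)) (hR2 : ∀ j, 1 ≤ j → m2Tensor (R j) = 0)
    (hbase : TshotOf Lc Jc 1 = TbalOf Lc Js 0) (hrec : StepRecursionUpTo Lc (TbalOf Lc Js) (TshotOf Lc Jc) (wStep Lc) R) :
    D1Tel Lc Js Jc :=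
  d1Tel_of_stepRecursionUpTo Js Jc hT0 hT1
    (admissibleTransport_of_stepRecursionUpTo (fun j _ κ l => constReproSum_wStep j κ l) (fun j _ κ l => linReproSum_wStep j κ l)
      (fun j _ κ l => absMoment₂_wStep j κ l) (OneStepKernelFamily.absMoment₂_TshotOf Jc) hT0 hT1 hR0 hR1
      (fun c e => by rw [hbase]; exact hT0 0 c e) (fun c e μ => by rw [hbase]; exact hT1 0 c e μ) hrec)
    hRA hR2 hbase hrec

/-- **THE FLOW-SUM IDENTITY FOR THE CANONICAL WEIGHT, MODULO A REMAINDER INVISIBLE AT THE READ-OUT LEVEL** — the socket for P6c at the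
read-out level (`F` additive, e.g. `ScalewiseVectorSeam.readout122 μ ν`, `μ ≠ ν`): the same binders with `hR2` replaced by
`hRF : ∀ j ≥ 1, F (m2Tensor (R j)) = 0` give `F (m2Tensor (TshotOf Lc Jc m)) = Σ_{j<m} F (m2Tensor (TbalOf Lc Js j))` for every `m ≥ 1`. [folklore] -/
theorem flowSum_of_stepRecursionUpTo_wStep (Js : ℕ → JetData 3 Lc) (Jc : ∀ m : ℕ, JetData 3 (Lc ^ m)) {R : ℕ → EKer 4}
    {F : Beta.HidentScalewise.Tensor4 → ℝ} (hFadd : ∀ A B, F (A + B) = F A + F B)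
    (hT0 : ∀ j (c e : Fin 4), HasSum (TbalOf Lc Js j c e) 0)
    (hT1 : ∀ j (c e ρ : Fin 4), HasSum (fun t : Fin 4 → ℤ => t ρ • TbalOf Lc Js j c e t) 0)
    (hR0 : ∀ j, 1 ≤ j → ∀ c e : Fin 4, HasSum (R j c e) 0)
    (hR1 : ∀ j, 1 ≤ j → ∀ c e ρ : Fin 4, HasSum (fun t : Fin 4 → ℤ => t ρ • R j c e t) 0)
    (hRA : ∀ j, 1 ≤ j → ∀ c e : Fin 4, AbsMoment₂ (R j c e)) (hRF : ∀ j, 1 ≤ j → F (m2Tensor (R j)) = 0)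
    (hbase : TshotOf Lc Jc 1 = TbalOf Lc Js 0) (hrec : StepRecursionUpTo Lc (TbalOf Lc Js) (TshotOf Lc Jc) (wStep Lc) R) :
    ∀ m : ℕ, 1 ≤ m → F (m2Tensor (TshotOf Lc Jc m)) = ∑ j ∈ range m, F (m2Tensor (TbalOf Lc Js j)) :=
  readout_sum_of_stepRecursionUpTo hFadd (hTA_TbalOf Js) hRA hRF
    (admissibleTransport_of_stepRecursionUpTo (fun j _ κ l => constReproSum_wStep j κ l) (fun j _ κ l => linReproSum_wStep j κ l)
      (fun j _ κ l => absMoment₂_wStep j κ l) (OneStepKernelFamily.absMoment₂_TshotOf Jc) hT0 hT1 hR0 hR1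
      (fun c e => by rw [hbase]; exact hT0 0 c e) (fun c e μ => by rw [hbase]; exact hT1 0 c e μ) hrec)
    (by rw [hbase]) hrec

/-- **THE TRANSPORT-FREE SECOND-MOMENT SOCKET**: (T0)/(T1) of the step kernels, the base identity and the one-step identity OF SECOND-MOMENT
TENSORS (`j ≥ 1`) give `D1Tel Lc Js Jc` — for a consumer who proves the second-moment step identity by other means. [folklore] -/
theorem d1Tel_of_m2Step (Js : ℕ → JetData 3 Lc) (Jc : ∀ m : ℕ, JetData 3 (Lc ^ m))
    (hT0 : ∀ j (c e : Fin 4), HasSum (TbalOf Lc Js j c e) 0)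
    (hT1 : ∀ j (c e ρ : Fin 4), HasSum (fun t : Fin 4 → ℤ => t ρ • TbalOf Lc Js j c e t) 0)
    (hbase : m2Tensor (TshotOf Lc Jc 1) = m2Tensor (TbalOf Lc Js 0))
    (hstep : ∀ j : ℕ, 1 ≤ j → m2Tensor (TshotOf Lc Jc (j + 1)) = m2Tensor (TshotOf Lc Jc j) + m2Tensor (TbalOf Lc Js j)) :
    D1Tel Lc Js Jc :=
  (hessianTelescoping_iff_m2Tensor_sum (𝒯 := TshotOf Lc Jc) (hTA_TbalOf Js) hT0 hT1).2 (m2Tensor_eq_sum_of_step hbase hstep)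

/-- `D1Tel` ⟺ (base + one-step identity of second-moment tensors), under (T0)/(T1) of the step kernels. [folklore] -/
theorem d1Tel_iff_m2Step (Js : ℕ → JetData 3 Lc) (Jc : ∀ m : ℕ, JetData 3 (Lc ^ m))
    (hT0 : ∀ j (c e : Fin 4), HasSum (TbalOf Lc Js j c e) 0)
    (hT1 : ∀ j (c e ρ : Fin 4), HasSum (fun t : Fin 4 → ℤ => t ρ • TbalOf Lc Js j c e t) 0) :
    D1Tel Lc Js Jc ↔
      m2Tensor (TshotOf Lc Jc 1) = m2Tensor (TbalOf Lc Js 0) ∧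
        ∀ j : ℕ, 1 ≤ j → m2Tensor (TshotOf Lc Jc (j + 1)) = m2Tensor (TshotOf Lc Jc j) + m2Tensor (TbalOf Lc Js j) := by
  refine ⟨fun h => ⟨?_, m2Tensor_step_of_d1Tel Js Jc hT0 hT1 h⟩, fun h => d1Tel_of_m2Step Js Jc hT0 hT1 h.1 h.2⟩
  have hsum := (hessianTelescoping_iff_m2Tensor_sum (𝒯 := TshotOf Lc Jc) (hTA_TbalOf Js) hT0 hT1).1 h
  rw [hsum 1 le_rfl, Finset.sum_range_one]

end NodeRemainder

/-! ## §9 (v1.4) The read-out socket IN THE LANGUAGE OF SECOND MOMENTS — the literal unfolding of the lead's `StepDriftWitness.D1Sum`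
(RULING (R27), journal l.54841: the (D1) telescoping binder is CUT AT THE READ-OUT LEVEL) -/

section SecondMomentSum

variable {Lc : ℕ} [NeZero Lc]

/-- **P6 AT THE READ-OUT LEVEL, BY SECOND MOMENTS**: (T0)/(T1) of the step kernels `TbalOf Lc Js j`; for the corrections `R j` (`j ≥ 1`) vanishing
zeroth and first decimated moments, absolutely summable second moments and VANISHING `(μ, ν)` SECOND MOMENT `secondMoment (R j) μ ν = 0` (P6c at
the read-out level); the base identity; and (R1) modulo `R` with `w = wStep Lc` — give, for every `m ≥ 1`,
`Σ_{j<m} secondMoment (TbalOf Lc Js j) μ ν = secondMoment (TshotOf Lc Jc m) μ ν`, i.e. LITERALLY the unfolding (`StepDriftWitness.d1Sum_iff`,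
`Iff.rfl`) of the lead's read-out-level binder `D1Sum Lc Js Jc μ ν` (= `flowSum_of_stepRecursionUpTo_wStep` at `F := readout122 μ ν`, rewritten by
`ScalewiseVectorSeam.readout122_m2Tensor`). [folklore] -/
theorem secondMomentSum_of_stepRecursionUpTo_wStep (Js : ℕ → JetData 3 Lc) (Jc : ∀ m : ℕ, JetData 3 (Lc ^ m)) {R : ℕ → EKer 4}
    (μ ν : Fin 4) (hT0 : ∀ j (c e : Fin 4), HasSum (TbalOf Lc Js j c e) 0)
    (hT1 : ∀ j (c e ρ : Fin 4), HasSum (fun t : Fin 4 → ℤ => t ρ • TbalOf Lc Js j c e t) 0)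
    (hR0 : ∀ j, 1 ≤ j → ∀ c e : Fin 4, HasSum (R j c e) 0)
    (hR1 : ∀ j, 1 ≤ j → ∀ c e ρ : Fin 4, HasSum (fun t : Fin 4 → ℤ => t ρ • R j c e t) 0)
    (hRA : ∀ j, 1 ≤ j → ∀ c e : Fin 4, AbsMoment₂ (R j c e)) (hRF : ∀ j, 1 ≤ j → B12Beta.secondMoment (R j) μ ν = 0)
    (hbase : TshotOf Lc Jc 1 = TbalOf Lc Js 0) (hrec : StepRecursionUpTo Lc (TbalOf Lc Js) (TshotOf Lc Jc) (wStep Lc) R) :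
    ∀ m : ℕ, 1 ≤ m → ∑ j ∈ range m, B12Beta.secondMoment (TbalOf Lc Js j) μ ν = B12Beta.secondMoment (TshotOf Lc Jc m) μ ν := by
  intro m hm
  have h := flowSum_of_stepRecursionUpTo_wStep Js Jc (F := ScalewiseVectorSeam.readout122 μ ν)
    (ScalewiseVectorSeam.readout122_add μ ν) hT0 hT1 hR0 hR1 hRA
    (fun j hj => by rw [ScalewiseVectorSeam.readout122_m2Tensor]; exact hRF j hj) hbase hrec m hm
  simp only [ScalewiseVectorSeam.readout122_m2Tensor] at h
  exact h.symm

/-- The same from P6c AT THE SECOND-MOMENT-TENSOR LEVEL (`m2Tensor (R j) = 0`, `j ≥ 1` — the level at which beta-an2 types P6c first; it implies the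
read-out level). [folklore] -/
theorem secondMomentSum_of_stepRecursionUpTo_wStep_m2 (Js : ℕ → JetData 3 Lc) (Jc : ∀ m : ℕ, JetData 3 (Lc ^ m)) {R : ℕ → EKer 4}
    (μ ν : Fin 4) (hT0 : ∀ j (c e : Fin 4), HasSum (TbalOf Lc Js j c e) 0)
    (hT1 : ∀ j (c e ρ : Fin 4), HasSum (fun t : Fin 4 → ℤ => t ρ • TbalOf Lc Js j c e t) 0)
    (hR0 : ∀ j, 1 ≤ j → ∀ c e : Fin 4, HasSum (R j c e) 0)
    (hR1 : ∀ j, 1 ≤ j → ∀ c e ρ : Fin 4, HasSum (fun t : Fin 4 → ℤ => t ρ • R j c e t) 0)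
    (hRA : ∀ j, 1 ≤ j → ∀ c e : Fin 4, AbsMoment₂ (R j c e)) (hR2 : ∀ j, 1 ≤ j → m2Tensor (R j) = 0)
    (hbase : TshotOf Lc Jc 1 = TbalOf Lc Js 0) (hrec : StepRecursionUpTo Lc (TbalOf Lc Js) (TshotOf Lc Jc) (wStep Lc) R) :
    ∀ m : ℕ, 1 ≤ m → ∑ j ∈ range m, B12Beta.secondMoment (TbalOf Lc Js j) μ ν = B12Beta.secondMoment (TshotOf Lc Jc m) μ ν :=
  secondMomentSum_of_stepRecursionUpTo_wStep Js Jc μ ν hT0 hT1 hR0 hR1 hRA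
    (fun j hj => by rw [← ScalewiseVectorSeam.readout122_m2Tensor, hR2 j hj]; rfl) hbase hrec

end SecondMomentSum

end Literature.MathematicalPhysics.QuantumFieldTheory.Balaban1983to89.Beta.HessianTelescopingKKT

end

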